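import Literature.Analysis.ODE.ConfinedAutonomous
import Literature.Geometry.Lorentzian.GeodesicProofs
import Mathlib.Algebra.QuadraticDiscriminant
import Mathlib.Analysis.SpecialFunctions.Pow.Real
import Mathlib.Geometry.Manifold.LocalDiffeomorph
import Mathlib.Analysis.Calculus.FDeriv.Analytic
import Mathlib.Analysis.Calculus.ContDiff.Operations
import Mathlib.Analysis.ODE.Gronwall
import Mathlib.Analysis.Calculus.MeanValue
import Mathlib.Topology.Covering.Basic
import HarnessLib

/-!
# Lifting rays through a local diffeomorphism with the Gauss property; evenly covered balls
(towards Lee, *Introduction to Riemannian Manifolds* (2018), Thm. 6.23 and Thm. 12.8)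

Third layer of the proof of the compact Cartan–Hadamard theorem
(`Literature.Geometry.Riemannian.Lee2018_cartanHadamard_compact`). Lee's Thm. 6.23 ("a local
isometry from a complete Riemannian manifold is a covering map") is proved there with metric balls
of the complete pulled-back metric and the Hopf–Rinow theorem. Here we isolate what is needed for
`π = exp_p : T_pM → M` and prove it WITHOUT Hopf–Rinow and without constructing the pulled-back
metric as an object: we work with a `C^∞` local diffeomorphism `f : E → M` from the model vector
space (`E = T_pM`) satisfying the **Gauss relation**
`g(df_x w, df_x x) = g_p(w, x)` (for `f = exp_p` this is the Gauss lemma,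
`gauss_lemma_expMap` of `CartanHadamardJacobi.lean`), a Riemannian `g`, and a chart
`Φ : E ⊇ B̄_ε → M` around a point `q = Φ 0` (for `exp` a normal chart, `exp_q` near `0`), along whose
straight rays the `g`-speed is controlled.

* **Lifting chart and lifting equation.** On `Ω = f⁻¹(Φ(B_ε))` the map `ψ = Φ⁻¹ ∘ f : Ω → B_ε` is
  a `C^∞` local diffeomorphism of open subsets of `E` (`contDiffOn_liftChart`,
  `exists_continuousLinearEquiv_fderiv_liftChart`); lifts of the chart segments `b + t a` are the
  solutions of the ODE `X' = (Dψ_X)⁻¹ a` on `E` (`liftChart_solution_eq`: `ψ(X t) = ψ(X 0) + t a`),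
  and they do not leave `Ω` as long as the segment stays in a smaller closed ball
  (`liftChart_solution_mem`, a first-exit argument).
* **A priori bound (the completeness mechanism of Lee's Cor. 6.20 in infinitesimal form).** By the
  Gauss relation and Cauchy–Schwarz, `ρ = g_p(X, X)` satisfies `|ρ'| ≤ 2 L √ρ ≤ ρ + L²` where `L`
  bounds the `g`-speed of `t ↦ Φ(b + t a)`; Grönwall gives `ρ ≤ (ρ(0) + L²) e` on `[0, 1]`
  (`val_solution_le`), so the orbit is confined to a compact subset of `Ω`, and the tree's
  `Literature.Analysis.ODE.exists_solution_of_confined` yields lifts on `[0, 1]`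
  (`exists_lift_of_segment`, `exists_inward_lift`, `exists_outward_lift`); lifts are unique and can
  be reversed (`liftChart_solution_unique`, `liftChart_solution_reverse`).
* **Evenly covered balls.** The endpoint of the inward lift (from `x̃ ∈ Ω` along `(1-t) ψ x̃` down
  to the fibre over `q`) is a locally constant function of `x̃` (`inward_lift_endpoint_near`,
  Grönwall for approximate trajectories), and `x̃ ↦ (f x̃, endpoint)` is a homeomorphism
  `f⁻¹(Φ(B_ε)) ≃ Φ(B_ε) × f⁻¹{q}` whose inverse is the endpoint of the outward lift: the centre
  `q = Φ 0` is evenly covered (`isEvenlyCovered_of_liftChart`, Mathlib's `IsEvenlyCovered`).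

Everything is proved; no definitions and no named facts are introduced. The specialisation to
`f = exp_p`, `Φ = exp_q` (speeds of radial geodesics) and the covering/surjectivity conclusions are
in `CartanHadamardProofs.lean`.

## References

* J. M. Lee, *Introduction to Riemannian Manifolds*, 2nd ed., GTM 176, Springer 2018, Thm. 6.9,
  Cor. 6.20, Thm. 6.23 (and its proof, pp. 162–164), Thm. 12.8 (held:
  `book:lee2018-introduction-riemannian-manifolds`). [LeeRiemannianManifolds2018]
* G. Teschl, *Ordinary Differential Equations and Dynamical Systems* (2012), §2.4–2.6 (continuation,
  Grönwall). [Teschl2012]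
-/

noncomputable section

open Bundle Set Filter Function Metric
open scoped Manifold ContDiff Topology NNReal


namespace Literature.Geometry.Riemannian

universe u

variable {E : Type u} [NormedAddCommGroup E] [NormedSpace ℝ E] {H : Type*} [TopologicalSpace H]
  {I : ModelWithCorners ℝ E H} {M : Type*} [TopologicalSpace M] [ChartedSpace H M]
  [IsManifold I ∞ M]

/-! ### The lifting chart `ψ = Φ⁻¹ ∘ f` of a local diffeomorphism over a chart ball -/

section LiftChart

variable {f : E → M} (Φ : PartialDiffeomorph 𝓘(ℝ, E) I E M ∞) {ε : ℝ}

omit [IsManifold I ∞ M] in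
/-- The domain `Ω = f⁻¹(Φ(B_ε))` over a chart ball is open (for `f` continuous and the ball inside
the chart source). [folklore] -/
theorem isOpen_preimage_image_ball (hπ : Continuous f) (hε : closedBall (0 : E) ε ⊆ Φ.source) :
    IsOpen (f ⁻¹' (Φ '' ball (0 : E) ε)) :=
  (Φ.toOpenPartialHomeomorph.isOpen_image_of_subset_source isOpen_ball
    (ball_subset_closedBall.trans hε)).preimage hπ

omit [IsManifold I ∞ M] in
/-- On `Ω = f⁻¹(Φ(B_ε))` the chart value `ψ x = Φ⁻¹(f x)` lies in the ball and `Φ (ψ x) = f x`.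
[folklore] -/
theorem liftChart_mem_ball (hε : closedBall (0 : E) ε ⊆ Φ.source) {x : E}
    (hx : x ∈ f ⁻¹' (Φ '' ball (0 : E) ε)) :
    Φ.toPartialEquiv.symm (f x) ∈ ball (0 : E) ε ∧ Φ (Φ.toPartialEquiv.symm (f x)) = f x ∧
      f x ∈ Φ.target := by
  obtain ⟨v, hv, hvx⟩ := hx
  have hvs : v ∈ Φ.source := hε (ball_subset_closedBall hv)
  rw [← hvx]
  refine ⟨?_, ?_, Φ.toPartialEquiv.map_source hvs⟩
  · rw [Φ.toPartialEquiv.left_inv hvs]; exact hv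
  · show Φ.toPartialEquiv (Φ.toPartialEquiv.symm (Φ.toPartialEquiv v)) = Φ.toPartialEquiv v
    rw [Φ.toPartialEquiv.left_inv hvs]

omit [IsManifold I ∞ M] in
/-- **The lifting chart is smooth**: `ψ = Φ⁻¹ ∘ f` is `C^∞` on `Ω` (as a map of the vector space
`E`), `f` being `C^∞` and `Φ⁻¹` being `C^∞` on the chart target. [folklore] -/
theorem contDiffOn_liftChart (hπs : ContMDiff 𝓘(ℝ, E) I ∞ f)
    (hε : closedBall (0 : E) ε ⊆ Φ.source) :
    ContDiffOn ℝ ∞ (fun x : E ↦ Φ.toPartialEquiv.symm (f x)) (f ⁻¹' (Φ '' ball (0 : E) ε)) := by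
  have h1 : ContMDiffOn 𝓘(ℝ, E) 𝓘(ℝ, E) ∞ (fun x : E ↦ Φ.toPartialEquiv.symm (f x))
      (f ⁻¹' (Φ '' ball (0 : E) ε)) :=
    Φ.contMDiffOn_invFun.comp hπs.contMDiffOn fun x hx ↦ (liftChart_mem_ball Φ hε hx).2.2
  exact contMDiffOn_iff_contDiffOn.1 h1

omit [IsManifold I ∞ M] in
/-- **The differential of the lifting chart is invertible** at every point of `Ω`: it is the
composite of the differentials of the local diffeomorphisms `f` (at `x`) and `Φ⁻¹` (at `f x`).
[folklore] -/
theorem exists_continuousLinearEquiv_fderiv_liftChart (hπs : ContMDiff 𝓘(ℝ, E) I ∞ f)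
    (hπ : IsLocalDiffeomorph 𝓘(ℝ, E) I ∞ f) (hε : closedBall (0 : E) ε ⊆ Φ.source) {x : E}
    (hx : x ∈ f ⁻¹' (Φ '' ball (0 : E) ε)) :
    ∃ e : E ≃L[ℝ] E, (e : E →L[ℝ] E) = fderiv ℝ (fun x : E ↦ Φ.toPartialEquiv.symm (f x)) x := by
  obtain ⟨-, -, hxt⟩ := liftChart_mem_ball Φ hε hx
  have htop : (∞ : ℕ∞ω) ≠ 0 := by simp
  -- the two differentials as equivalences
  set A := (hπ x).mfderivToContinuousLinearEquiv htop with hA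
  have hsymm : IsLocalDiffeomorphAt I 𝓘(ℝ, E) ∞ Φ.toPartialEquiv.symm (f x) :=
    PartialDiffeomorph.isLocalDiffeomorphAt I 𝓘(ℝ, E) ∞ Φ.symm hxt
  set B := hsymm.mfderivToContinuousLinearEquiv htop with hB
  refine ⟨A.trans B, ?_⟩
  -- the chain rule
  have hdπ : MDifferentiableAt 𝓘(ℝ, E) I f x := (hπs x).mdifferentiableAt htop
  have hdΦ : MDifferentiableAt I 𝓘(ℝ, E) Φ.toPartialEquiv.symm (f x) :=
    hsymm.mdifferentiableAt htop
  have hcomp : mfderiv 𝓘(ℝ, E) 𝓘(ℝ, E) (fun x : E ↦ Φ.toPartialEquiv.symm (f x)) x =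
      (mfderiv I 𝓘(ℝ, E) Φ.toPartialEquiv.symm (f x)).comp (mfderiv 𝓘(ℝ, E) I f x) :=
    mfderiv_comp x hdΦ hdπ
  rw [← mfderiv_eq_fderiv, hcomp]
  ext v
  rfl

omit [IsManifold I ∞ M] in
/-- The lifting field `G_a(x) = (Dψ_x)⁻¹ a` inverts the differential of the chart:
`Dψ_x (G_a x) = a` on `Ω`. [folklore] -/
theorem fderiv_liftChart_apply_inverse (hπs : ContMDiff 𝓘(ℝ, E) I ∞ f)
    (hπ : IsLocalDiffeomorph 𝓘(ℝ, E) I ∞ f) (hε : closedBall (0 : E) ε ⊆ Φ.source) {x : E}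
    (hx : x ∈ f ⁻¹' (Φ '' ball (0 : E) ε)) (a : E) :
    fderiv ℝ (fun x : E ↦ Φ.toPartialEquiv.symm (f x)) x
      ((fderiv ℝ (fun x : E ↦ Φ.toPartialEquiv.symm (f x)) x).inverse a) = a := by
  obtain ⟨e, he⟩ := exists_continuousLinearEquiv_fderiv_liftChart Φ hπs hπ hε hx
  rw [← he, ContinuousLinearMap.inverse_equiv]
  simp

omit [IsManifold I ∞ M] in
/-- **The lifting field is smooth**: `x ↦ (Dψ_x)⁻¹ a` is `C^∞` on `Ω` (the differential is `C^∞`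
there, inversion is smooth on invertible maps, Mathlib's `contDiffAt_map_inverse`). [folklore] -/
theorem contDiffOn_liftField (hπs : ContMDiff 𝓘(ℝ, E) I ∞ f)
    (hπ : IsLocalDiffeomorph 𝓘(ℝ, E) I ∞ f) (hε : closedBall (0 : E) ε ⊆ Φ.source)
    [CompleteSpace E] (a : E) :
    ContDiffOn ℝ ∞ (fun x : E ↦ (fderiv ℝ (fun x : E ↦ Φ.toPartialEquiv.symm (f x)) x).inverse a)
      (f ⁻¹' (Φ '' ball (0 : E) ε)) := by
  have hO := isOpen_preimage_image_ball Φ hπs.continuous hε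
  have hD : ContDiffOn ℝ ∞ (fderiv ℝ (fun x : E ↦ Φ.toPartialEquiv.symm (f x)))
      (f ⁻¹' (Φ '' ball (0 : E) ε)) :=
    ((contDiffOn_liftChart Φ hπs hε).fderiv_of_isOpen hO le_rfl)
  intro x hx
  obtain ⟨e, he⟩ := exists_continuousLinearEquiv_fderiv_liftChart Φ hπs hπ hε hx
  have hinv : ContDiffAt ℝ ∞ (ContinuousLinearMap.inverse : (E →L[ℝ] E) → E →L[ℝ] E)
      (fderiv ℝ (fun x : E ↦ Φ.toPartialEquiv.symm (f x)) x) := by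
    rw [← he]; exact contDiffAt_map_inverse e
  exact ((hinv.comp_contDiffWithinAt x (hD x hx)).clm_apply contDiffWithinAt_const)

/-! #### Solutions of the lifting equation are lifts of straight segments -/

omit [IsManifold I ∞ M] in
/-- **Along a solution of `X' = (Dψ_X)⁻¹ a` inside `Ω` the chart value moves on a straight line**:
if `X` solves the lifting equation within `[0, s]` and stays in `Ω`, then
`ψ (X t) = ψ (X 0) + t a` on `[0, s]` (chain rule and constancy of a function with vanishing
right derivative). [folklore] -/
theorem liftChart_solution_eq (hπs : ContMDiff 𝓘(ℝ, E) I ∞ f)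
    (hπ : IsLocalDiffeomorph 𝓘(ℝ, E) I ∞ f) (hε : closedBall (0 : E) ε ⊆ Φ.source) {a : E}
    {X : ℝ → E} {s : ℝ}
    (hX : ∀ t ∈ Icc 0 s, HasDerivWithinAt X
      ((fderiv ℝ (fun x : E ↦ Φ.toPartialEquiv.symm (f x)) (X t)).inverse a) (Icc 0 s) t)
    (hXΩ : ∀ t ∈ Icc 0 s, X t ∈ f ⁻¹' (Φ '' ball (0 : E) ε)) :
    ∀ t ∈ Icc 0 s, Φ.toPartialEquiv.symm (f (X t)) = Φ.toPartialEquiv.symm (f (X 0)) + t • a := by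
  have hO := isOpen_preimage_image_ball Φ hπs.continuous hε
  set ψ : E → E := fun x ↦ Φ.toPartialEquiv.symm (f x) with hψ
  -- the function `t ↦ ψ (X t) - t a` has vanishing derivative within `[0, s]`
  have hd : ∀ t ∈ Icc 0 s, HasDerivWithinAt (fun t ↦ ψ (X t) - t • a) 0 (Icc 0 s) t := by
    intro t ht
    have hψd : HasFDerivAt ψ (fderiv ℝ ψ (X t)) (X t) :=
      (((contDiffOn_liftChart Φ hπs hε).differentiableOn (by simp)) (X t)
        (hXΩ t ht)).differentiableAt (hO.mem_nhds (hXΩ t ht)) |>.hasFDerivAt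
    have h1 := hψd.comp_hasDerivWithinAt t (hX t ht)
    rw [fderiv_liftChart_apply_inverse Φ hπs hπ hε (hXΩ t ht)] at h1
    have h2 : HasDerivWithinAt (fun t : ℝ ↦ t • a) ((1 : ℝ) • a) (Icc 0 s) t :=
      ((hasDerivAt_id t).smul_const a).hasDerivWithinAt
    have h3 := h1.fun_sub h2
    rw [one_smul, sub_self] at h3
    exact h3
  have hcont : ContinuousOn (fun t ↦ ψ (X t) - t • a) (Icc 0 s) := fun t ht ↦
    (hd t ht).continuousWithinAt
  intro t ht
  have key := constant_of_has_deriv_right_zero hcont (fun t' ht' ↦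
    (hd t' (Ico_subset_Icc_self ht')).mono_of_mem_nhdsWithin
      (mem_of_superset (Icc_mem_nhdsGE ht'.2) (Icc_subset_Icc_left ht'.1))) t ht
  simp only [zero_smul, sub_zero] at key
  exact eq_add_of_sub_eq key

omit [IsManifold I ∞ M] in
/-- **Solutions of the lifting equation do not leave `Ω` while the segment stays in the chart
ball.** Let `X` solve `X' = (Dψ_X)⁻¹ a` within `[0, s]`, `s ≤ 1`, with `X 0 ∈ Ω`, and suppose the
segment `ψ (X 0) + t a`, `t ∈ [0, 1]`, lies in the closed ball of radius `R₀ < ε`. Then `X t ∈ Ω`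
for all `t ∈ [0, s]` (and hence `ψ (X t) = ψ (X 0) + t a`): at a first exit time `t*`,
`f (X t*) = lim Φ(ψ(X 0) + t a) = Φ(ψ (X 0) + t* a)` would still lie in `Φ(B_ε)`. [folklore] -/
theorem liftChart_solution_mem [T2Space M] (hπs : ContMDiff 𝓘(ℝ, E) I ∞ f)
    (hπ : IsLocalDiffeomorph 𝓘(ℝ, E) I ∞ f) (hε : closedBall (0 : E) ε ⊆ Φ.source) {a : E}
    {X : ℝ → E} {s R₀ : ℝ} (hs : s ≤ 1) (hR₀ : R₀ < ε)
    (hX : ∀ t ∈ Icc 0 s, HasDerivWithinAt X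
      ((fderiv ℝ (fun x : E ↦ Φ.toPartialEquiv.symm (f x)) (X t)).inverse a) (Icc 0 s) t)
    (hX0 : X 0 ∈ f ⁻¹' (Φ '' ball (0 : E) ε))
    (hseg : ∀ t ∈ Icc (0 : ℝ) 1, Φ.toPartialEquiv.symm (f (X 0)) + t • a ∈ closedBall (0 : E) R₀) :
    ∀ t ∈ Icc 0 s, X t ∈ f ⁻¹' (Φ '' ball (0 : E) ε) := by
  have hO := isOpen_preimage_image_ball Φ hπs.continuous hε
  set Ω : Set E := f ⁻¹' (Φ '' ball (0 : E) ε) with hΩ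
  set b : E := Φ.toPartialEquiv.symm (f (X 0)) with hb
  have hXc : ContinuousOn X (Icc 0 s) := fun t ht ↦ (hX t ht).continuousWithinAt
  by_contra hcon
  push Not at hcon
  -- the first exit time
  set Bad : Set ℝ := Icc 0 s ∩ X ⁻¹' Ωᶜ with hBad
  have hBc : IsClosed Bad := hXc.preimage_isClosed_of_isClosed isClosed_Icc hO.isClosed_compl
  obtain ⟨t₁, ht₁, ht₁Ω⟩ := hcon
  have hBne : Bad.Nonempty := ⟨t₁, ht₁, ht₁Ω⟩
  have hBbdd : BddBelow Bad := ⟨0, fun t ht ↦ ht.1.1⟩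
  set tstar := sInf Bad with htstar
  have hmem : tstar ∈ Bad := hBc.csInf_mem hBne hBbdd
  have hts : tstar ∈ Icc 0 s := hmem.1
  have hnot : X tstar ∉ Ω := hmem.2
  have hgood : ∀ t ∈ Icc 0 s, t < tstar → X t ∈ Ω := fun t ht hlt ↦ by
    by_contra h
    exact not_le.2 hlt (csInf_le hBbdd ⟨ht, h⟩)
  have hpos : 0 < tstar := by
    rcases hts.1.eq_or_lt with h | h
    · exact absurd (h ▸ hX0) hnot
    · exact h
  -- on `[0, tstar)` the chart value is the straight segment
  have hline : ∀ t ∈ Ico 0 tstar, Φ.toPartialEquiv.symm (f (X t)) = b + t • a := by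
    intro t ht
    have hsub : ∀ t' ∈ Icc 0 t, X t' ∈ Ω := fun t' ht' ↦
      hgood t' ⟨ht'.1, ht'.2.trans (ht.2.le.trans hts.2)⟩ (ht'.2.trans_lt ht.2)
    exact liftChart_solution_eq Φ hπs hπ hε
      (fun t' ht' ↦ (hX t' ⟨ht'.1, ht'.2.trans (ht.2.le.trans hts.2)⟩).mono
        (Icc_subset_Icc_right (ht.2.le.trans hts.2))) hsub t ⟨ht.1, le_rfl⟩
  -- hence `f (X t) = Φ (b + t a)` there, and at `tstar` by continuity
  have hπX : ∀ t ∈ Ico 0 tstar, f (X t) = Φ (b + t • a) := by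
    intro t ht
    have h := (liftChart_mem_ball Φ hε (hgood t ⟨ht.1, ht.2.le.trans hts.2⟩ ht.2)).2.1
    rw [hline t ht] at h
    exact h.symm
  have hsegs : ∀ t ∈ Icc 0 tstar, b + t • a ∈ Φ.source := fun t ht ↦
    hε ((closedBall_subset_closedBall hR₀.le) (hseg t ⟨ht.1, ht.2.trans (hts.2.trans hs)⟩))
  have hc1 : ContinuousWithinAt (fun t ↦ f (X t)) (Icc 0 tstar) tstar :=
    hπs.continuous.continuousAt.comp_continuousWithinAt
      ((hXc tstar hts).mono (Icc_subset_Icc_right hts.2))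
  have hc2 : ContinuousWithinAt (fun t ↦ Φ (b + t • a)) (Icc 0 tstar) tstar := by
    have hl : Continuous fun t : ℝ ↦ b + t • a := continuous_const.add (continuous_id.smul continuous_const)
    refine ContinuousAt.comp_continuousWithinAt ?_ hl.continuousWithinAt
    exact (Φ.contMDiffOn.continuousOn.continuousAt
      (Φ.open_source.mem_nhds (hsegs tstar ⟨hts.1, le_rfl⟩)))
  have heq : f (X tstar) = Φ (b + tstar • a) := by
    -- both sides are limits along `[0, tstar)` of functions agreeing there
    have hnebot : (𝓝[Ico 0 tstar] tstar).NeBot := by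
      rw [← mem_closure_iff_nhdsWithin_neBot, closure_Ico hpos.ne]
      exact ⟨hts.1, le_rfl⟩
    have h1 : Tendsto (fun t ↦ f (X t)) (𝓝[Ico 0 tstar] tstar) (𝓝 (f (X tstar))) :=
      hc1.tendsto.mono_left (nhdsWithin_mono _ Ico_subset_Icc_self)
    have h2 : Tendsto (fun t ↦ Φ (b + t • a)) (𝓝[Ico 0 tstar] tstar) (𝓝 (Φ (b + tstar • a))) :=
      hc2.tendsto.mono_left (nhdsWithin_mono _ Ico_subset_Icc_self)
    have h3 : (fun t ↦ f (X t)) =ᶠ[𝓝[Ico 0 tstar] tstar] fun t ↦ Φ (b + t • a) :=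
      eventually_nhdsWithin_of_forall fun t ht ↦ hπX t ht
    exact tendsto_nhds_unique_of_eventuallyEq h1 h2 h3
  -- contradiction: `Φ (b + tstar a) ∈ Φ(B_ε)`
  apply hnot
  show f (X tstar) ∈ Φ '' ball (0 : E) ε
  rw [heq]
  refine ⟨b + tstar • a, ?_, rfl⟩
  exact (closedBall_subset_ball hR₀) (hseg tstar ⟨hts.1, hts.2.trans hs⟩)

end LiftChart

/-! ### Positive definite metrics: Cauchy–Schwarz and comparison with the model norm -/

section MetricLemmas

open Literature.Geometry.Lorentzian

variable {n : ℕ∞ω} (g : PseudoRiemannianMetric I n E (TangentSpace I : M → Type _))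

/-- **Cauchy–Schwarz** for a positive semidefinite metric: `g(a, b)² ≤ g(a, a) g(b, b)`
(discriminant of the nonnegative quadratic `λ ↦ g(a - λ b, a - λ b)`). [folklore] -/
theorem val_sq_le_mul (hpos : ∀ (x : M) (v : TangentSpace I x), 0 ≤ g.val x v v) (x : M)
    (a b : TangentSpace I x) : (g.val x a b) ^ 2 ≤ g.val x a a * g.val x b b := by
  have hquad : ∀ r : ℝ, 0 ≤ g.val x b b * (r * r) + (-(2 * g.val x a b)) * r + g.val x a a := by
    intro r
    have h := hpos x (a - r • b)
    have hexp : g.val x (a - r • b) (a - r • b) =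
        g.val x b b * (r * r) + (-(2 * g.val x a b)) * r + g.val x a a := by
      simp only [map_sub, map_smul, sub_apply, smul_apply, smul_eq_mul, g.symm x b a]
      ring
    rw [hexp] at h
    exact h
  have hd := discrim_le_zero hquad
  rw [discrim] at hd
  nlinarith [hd]

/-- `|g(a, b)| ≤ √g(a,a) · √g(b,b)` for a positive semidefinite metric. [folklore] -/
theorem abs_val_le_sqrt_mul_sqrt (hpos : ∀ (x : M) (v : TangentSpace I x), 0 ≤ g.val x v v)
    (x : M) (a b : TangentSpace I x) :
    |g.val x a b| ≤ Real.sqrt (g.val x a a) * Real.sqrt (g.val x b b) := by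
  rw [← Real.sqrt_mul (hpos x a), ← Real.sqrt_sq_eq_abs]
  exact Real.sqrt_le_sqrt (val_sq_le_mul g hpos x a b)

/-- **A positive definite form on the (finite-dimensional) model space dominates the norm**:
there is `c > 0` with `c ‖v‖² ≤ g_p(v, v)` for all `v ∈ T_pM = E` (minimum of the continuous
positive function `g_p(v, v)` on the compact unit sphere; trivial if `E = 0`). [folklore] -/
theorem exists_pos_mul_norm_sq_le_val_point [FiniteDimensional ℝ E] (hg : g.IsRiemannian) (p : M) :
    ∃ c > (0 : ℝ), ∀ v : E, c * ‖v‖ ^ 2 ≤ g.val p v v := by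
  set B : E →L[ℝ] E →L[ℝ] ℝ := g.val p with hB
  have hBpos : ∀ v : E, v ≠ 0 → 0 < B v v := fun v hv ↦ hg p v hv
  change ∃ c > (0 : ℝ), ∀ v : E, c * ‖v‖ ^ 2 ≤ B v v
  rcases subsingleton_or_nontrivial E with hE | hE
  · refine ⟨1, one_pos, fun v ↦ ?_⟩
    rw [Subsingleton.elim v 0, norm_zero, map_zero]
    simp
  · -- minimum on the unit sphere
    have hS : IsCompact (sphere (0 : E) 1) := isCompact_sphere 0 1
    have hSne : (sphere (0 : E) 1).Nonempty := by
      obtain ⟨v, hv⟩ := exists_ne (0 : E)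
      exact ⟨‖v‖⁻¹ • v, by simp [norm_smul, hv]⟩
    have hcont : ContinuousOn (fun v : E ↦ B v v) (sphere (0 : E) 1) :=
      (B.continuous₂.comp (continuous_id.prodMk continuous_id)).continuousOn
    obtain ⟨v₀, hv₀, hmin⟩ := hS.exists_isMinOn hSne hcont
    have hv₀ne : (v₀ : E) ≠ 0 := by
      intro h; rw [h] at hv₀; simp at hv₀
    refine ⟨B v₀ v₀, hBpos v₀ hv₀ne, fun v ↦ ?_⟩
    by_cases hv : v = 0
    · rw [hv, norm_zero, map_zero]; simp
    · have hnv : 0 < ‖v‖ := norm_pos_iff.2 hv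
      have hu : ‖v‖⁻¹ • v ∈ sphere (0 : E) 1 := by
        simp [norm_smul, hv]
      have h1 := hmin hu
      simp only [mem_setOf_eq, map_smul, smul_apply, smul_eq_mul] at h1
      -- `B v₀ v₀ ≤ ‖v‖⁻² B v v`
      rw [← mul_assoc, ← sq, inv_pow, ← div_eq_inv_mul, le_div_iff₀ (by positivity)] at h1
      exact h1

end MetricLemmas

/-! ### The radial (Gauss) bound along solutions of the lifting equation; existence of lifts -/

section GaussBound

open Literature.Geometry.Lorentzian

variable {f : E → M} (Φ : PartialDiffeomorph 𝓘(ℝ, E) I E M ∞) {ε : ℝ} {n : ℕ∞ω}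
  (g : PseudoRiemannianMetric I n E (TangentSpace I : M → Type _)) {p : M}

/-- **The a priori bound from the Gauss lemma.** Let `f : T_pM = E → M` be a `C^∞` local
diffeomorphism satisfying the Gauss relation `g(df_x w, df_x x) = g_p(w, x)` (as `exp_p` does),
`g` positive semidefinite, and let `X` solve the lifting equation `X' = (Dψ_X)⁻¹ a` within
`[0, s]`, `s ≤ 1`, staying in `Ω`, so that `f (X t) = Φ(b + t a)`; if the curve
`t ↦ Φ(b + t a)` has `g`-speed at most `L` on `[0, 1]`, then `ρ = g_p(X, X)` satisfies
`|ρ'| ≤ 2 L √ρ ≤ ρ + L²`, hence `ρ(t) ≤ (ρ(0) + L²) e` on `[0, s]` (Gronwall). This is the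
completeness mechanism of Lee 2018, Cor. 6.20 / Thm. 6.23 in infinitesimal form: the radial
function of `T_pM` is `1`-Lipschitz for the pulled-back metric. [cite: LeeRiemannianManifolds2018, Thm. 6.23 (proof)] -/
theorem val_solution_le [T2Space M] [CompleteSpace E] (hπs : ContMDiff 𝓘(ℝ, E) I ∞ f)
    (hπ : IsLocalDiffeomorph 𝓘(ℝ, E) I ∞ f) (hε : closedBall (0 : E) ε ⊆ Φ.source)
    (hpos : ∀ (x : M) (v : TangentSpace I x), 0 ≤ g.val x v v)
    (hgauss : ∀ x w : E, g.val (f x) (mfderiv 𝓘(ℝ, E) I f x w) (mfderiv 𝓘(ℝ, E) I f x x) =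
      g.val p w x)
    {a b : E} {X : ℝ → E} {s L : ℝ} (hL : 0 ≤ L)
    (hX : ∀ t ∈ Icc 0 s, HasDerivWithinAt X
      ((fderiv ℝ (fun x : E ↦ Φ.toPartialEquiv.symm (f x)) (X t)).inverse a) (Icc 0 s) t)
    (hXΩ : ∀ t ∈ Icc 0 s, X t ∈ f ⁻¹' (Φ '' ball (0 : E) ε))
    (hfX : ∀ t ∈ Icc 0 s, f (X t) = Φ (b + t • a))
    (hspeed : ∀ t ∈ Icc (0 : ℝ) 1, g.val (Φ (b + t • a)) (velocity I (fun t : ℝ ↦ Φ (b + t • a)) t)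
      (velocity I (fun t : ℝ ↦ Φ (b + t • a)) t) ≤ L ^ 2) (hs : s ≤ 1) :
    ∀ t ∈ Icc 0 s, g.val p (X t) (X t) ≤ (g.val p (X 0) (X 0) + L ^ 2) * Real.exp 1 := by
  set B : E →L[ℝ] E →L[ℝ] ℝ := g.val p with hB
  set ρ : ℝ → ℝ := fun t ↦ B (X t) (X t) with hρ
  set G : E → E := fun x ↦ (fderiv ℝ (fun x : E ↦ Φ.toPartialEquiv.symm (f x)) x).inverse a
    with hG
  have hρnn : ∀ t, 0 ≤ ρ t := fun t ↦ hpos p (X t)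
  -- derivative of `ρ` within `[0, s]`
  have hρd : ∀ t ∈ Icc 0 s, HasDerivWithinAt ρ (2 * B (G (X t)) (X t)) (Icc 0 s) t := by
    intro t ht
    have h1 : HasDerivWithinAt (fun t ↦ B (X t)) (B (G (X t))) (Icc 0 s) t :=
      B.hasFDerivAt.comp_hasDerivWithinAt t (hX t ht)
    have h2 := h1.clm_apply (hX t ht)
    have hBsymm : ∀ u w : E, B u w = B w u := fun u w ↦ g.symm p u w
    have heq : B (G (X t)) (X t) + B (X t) (G (X t)) = 2 * B (G (X t)) (X t) := by
      rw [hBsymm (X t) (G (X t))]; ring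
    rw [heq] at h2
    exact h2
  -- the velocity of `f ∘ X` at interior times
  have hvel : ∀ t ∈ Ioo 0 s, mfderiv 𝓘(ℝ, E) I f (X t) (G (X t)) =
      velocity I (fun t : ℝ ↦ Φ (b + t • a)) t := by
    intro t ht
    have hXd : HasDerivAt X (G (X t)) t :=
      (hX t (Ioo_subset_Icc_self ht)).hasDerivAt (Icc_mem_nhds ht.1 ht.2)
    have hXm : HasMFDerivAt 𝓘(ℝ, ℝ) 𝓘(ℝ, E) X t
        (ContinuousLinearMap.smulRight (1 : ℝ →L[ℝ] ℝ) (G (X t))) :=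
      hasMFDerivAt_iff_hasFDerivAt.2 hXd.hasFDerivAt
    have hfm : HasMFDerivAt 𝓘(ℝ, E) I f (X t) (mfderiv 𝓘(ℝ, E) I f (X t)) :=
      ((hπs (X t)).mdifferentiableAt (by simp)).hasMFDerivAt
    have hcomp := hfm.comp t hXm
    have hev : (fun t : ℝ ↦ Φ (b + t • a)) =ᶠ[𝓝 t] (f ∘ X) :=
      Filter.eventuallyEq_of_mem (Ioo_mem_nhds ht.1 ht.2) fun t' ht' ↦
        (hfX t' (Ioo_subset_Icc_self ht')).symm
    rw [velocity_congr_of_eventuallyEq (I := I) hev]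
    have h1 : (ContinuousLinearMap.smulRight (1 : ℝ →L[ℝ] ℝ) (G (X t))) (1 : ℝ) = G (X t) := by
      simp
    unfold velocity
    rw [hcomp.mfderiv]
    exact (congrArg (mfderiv 𝓘(ℝ, E) I f (X t)) h1).symm
  -- the bound `|ρ'| ≤ ρ + L²` at interior times
  have hbound : ∀ t ∈ Ioo 0 s, ‖2 * B (G (X t)) (X t)‖ ≤ 1 * ‖ρ t‖ + L ^ 2 := by
    intro t ht
    have hg1 : B (G (X t)) (X t) =
        g.val (f (X t)) (mfderiv 𝓘(ℝ, E) I f (X t) (G (X t))) (mfderiv 𝓘(ℝ, E) I f (X t) (X t)) :=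
      (hgauss (X t) (G (X t))).symm
    have hg2 : g.val (f (X t)) (mfderiv 𝓘(ℝ, E) I f (X t) (X t)) (mfderiv 𝓘(ℝ, E) I f (X t) (X t)) =
        ρ t := hgauss (X t) (X t)
    have hcs := abs_val_le_sqrt_mul_sqrt g hpos (f (X t)) (mfderiv 𝓘(ℝ, E) I f (X t) (G (X t)))
      (mfderiv 𝓘(ℝ, E) I f (X t) (X t))
    rw [hg2, ← hg1, hvel t ht] at hcs
    have ht1 : t ∈ Icc (0 : ℝ) 1 := ⟨ht.1.le, ht.2.le.trans hs⟩
    have hsp := hspeed t ht1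
    rw [hfX t (Ioo_subset_Icc_self ht)] at hcs
    have hsqL : Real.sqrt (g.val (Φ (b + t • a)) (velocity I (fun t : ℝ ↦ Φ (b + t • a)) t)
        (velocity I (fun t : ℝ ↦ Φ (b + t • a)) t)) ≤ L := by
      rw [← Real.sqrt_sq hL]
      exact Real.sqrt_le_sqrt hsp
    have hρ0 : 0 ≤ ρ t := hρnn t
    have h3 : |B (G (X t)) (X t)| ≤ L * Real.sqrt (ρ t) :=
      hcs.trans (mul_le_mul_of_nonneg_right hsqL (Real.sqrt_nonneg _))
    have h4 : 2 * (L * Real.sqrt (ρ t)) ≤ ρ t + L ^ 2 := by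
      nlinarith [Real.sq_sqrt hρ0, sq_nonneg (L - Real.sqrt (ρ t))]
    rw [Real.norm_eq_abs, Real.norm_eq_abs, abs_mul, abs_of_pos (zero_lt_two' ℝ),
      abs_of_nonneg hρ0, one_mul]
    linarith
  -- Gronwall on `[0, s]`
  rcases le_or_gt s 0 with hs0 | hs0
  · intro t ht
    have ht0 : t = 0 := le_antisymm (ht.2.trans hs0) ht.1
    rw [ht0]
    have := hρnn 0
    change ρ 0 ≤ (ρ 0 + L ^ 2) * Real.exp 1
    nlinarith [Real.add_one_le_exp (1 : ℝ), sq_nonneg L]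
  have hcont : ContinuousOn ρ (Icc 0 s) := fun t ht ↦ (hρd t ht).continuousWithinAt
  have key := norm_le_gronwallBound_of_norm_deriv_right_le (f := ρ)
    (f' := fun t ↦ 2 * B (G (X t)) (X t)) (δ := ρ 0) (K := 1) (ε := L ^ 2) (a := 0) (b := s)
    hcont (fun t ht ↦ ?_) (by rw [Real.norm_eq_abs, abs_of_nonneg (hρnn 0)]) (fun t ht ↦ ?_)
  · intro t ht
    have h := key t ht
    rw [Real.norm_eq_abs, abs_of_nonneg (hρnn t), sub_zero,
      gronwallBound_of_K_ne_0 one_ne_zero] at h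
    simp only [one_mul, div_one] at h
    have hexp : Real.exp t ≤ Real.exp 1 := Real.exp_le_exp.2 (ht.2.trans hs)
    have hρ00 : 0 ≤ ρ 0 := hρnn 0
    have hex0 : 0 ≤ Real.exp t - 1 := by linarith [Real.add_one_le_exp t, ht.1]
    change ρ t ≤ (ρ 0 + L ^ 2) * Real.exp 1
    calc ρ t ≤ ρ 0 * Real.exp t + L ^ 2 * (Real.exp t - 1) := h
      _ ≤ ρ 0 * Real.exp 1 + L ^ 2 * Real.exp 1 := by
          nlinarith [sq_nonneg L, Real.exp_pos t]
      _ = (ρ 0 + L ^ 2) * Real.exp 1 := by ring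
  · -- right derivative at `t ∈ [0, s)`
    exact (hρd t (Ico_subset_Icc_self ht)).mono_of_mem_nhdsWithin
      (mem_of_superset (Icc_mem_nhdsGE ht.2) (Icc_subset_Icc_left ht.1))
  · -- the bound at `t ∈ [0, s)`: interior times directly, `t = 0` by continuity
    rcases ht.1.eq_or_lt with h0 | h0
    · subst h0
      have hO := isOpen_preimage_image_ball Φ hπs.continuous hε
      have ht' : (0 : ℝ) ∈ Icc 0 s := Ico_subset_Icc_self ht
      have hXc : ContinuousWithinAt X (Icc 0 s) 0 := (hX 0 ht').continuousWithinAt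
      have hGX : ContinuousWithinAt (fun t ↦ G (X t)) (Icc 0 s) 0 :=
        ((contDiffOn_liftField Φ hπs hπ hε a).continuousOn.continuousAt
          (hO.mem_nhds (hXΩ 0 ht'))).comp_continuousWithinAt hXc
      have hF'c : ContinuousWithinAt (fun t ↦ ‖2 * B (G (X t)) (X t)‖) (Icc 0 s) 0 :=
        (continuousWithinAt_const.mul
          (B.continuous₂.continuousAt.comp_continuousWithinAt (hGX.prodMk hXc))).norm
      have hRc : ContinuousWithinAt (fun t ↦ 1 * ‖ρ t‖ + L ^ 2) (Icc 0 s) 0 :=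
        (continuousWithinAt_const.mul (hcont 0 ht').norm).add continuousWithinAt_const
      have hnebot : (𝓝[Ioo 0 s] (0 : ℝ)).NeBot := by
        rw [← mem_closure_iff_nhdsWithin_neBot, closure_Ioo hs0.ne]
        exact ⟨le_rfl, hs0.le⟩
      refine le_of_tendsto_of_tendsto (hF'c.tendsto.mono_left (nhdsWithin_mono _ Ioo_subset_Icc_self))
        (hRc.tendsto.mono_left (nhdsWithin_mono _ Ioo_subset_Icc_self)) ?_
      exact eventually_nhdsWithin_of_forall fun t ht ↦ hbound t ht
    · exact hbound t ⟨h0, ht.2⟩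

end GaussBound

/-! ### Existence of lifts of chart segments -/

section LiftExistence

open Literature.Geometry.Lorentzian

variable {f : E → M} (Φ : PartialDiffeomorph 𝓘(ℝ, E) I E M ∞) {ε : ℝ} {n : ℕ∞ω}
  (g : PseudoRiemannianMetric I n E (TangentSpace I : M → Type _)) {p : M}

/-- **Lifts of chart segments exist.** Let `f : T_pM = E → M` be a `C^∞` local diffeomorphism
with the Gauss relation `g(df_x w, df_x x) = g_p(w, x)` for a Riemannian `g` (finite-dimensional
`E`), `Φ` a chart at the target with `closedBall 0 ε ⊆ Φ.source`, `x₀ ∈ Ω = f⁻¹(Φ(B_ε))` and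
`a ∈ E` such that the segment `ψ x₀ + t a`, `t ∈ [0,1]`, stays in a closed ball of radius `R₀ < ε`
and the curve `t ↦ Φ(ψ x₀ + t a)` has `g`-speed `≤ L`. Then the lifting equation
`X' = (Dψ_X)⁻¹ a`, `X 0 = x₀` has a solution on `[0, 1]`, which stays in `Ω` and satisfies
`ψ (X t) = ψ x₀ + t a`, i.e. `f (X t) = Φ (ψ x₀ + t a)`: the orbit is a priori confined to the
compact set `{‖x‖ ≤ R} ∩ f⁻¹(Φ(closedBall 0 R₀))` (`val_solution_le`, `liftChart_solution_mem`),
so `Literature.Analysis.ODE.exists_solution_of_confined` applies. This is the path-lifting step of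
Lee 2018, Thm. 6.23 ("`π` possesses the path-lifting property for geodesics"), here for the chart
segments of a normal ball. [cite: LeeRiemannianManifolds2018, Thm. 6.23 (proof)] -/
theorem exists_lift_of_segment [T2Space M] [CompleteSpace E] [FiniteDimensional ℝ E]
    (hπs : ContMDiff 𝓘(ℝ, E) I ∞ f) (hπ : IsLocalDiffeomorph 𝓘(ℝ, E) I ∞ f)
    (hε : closedBall (0 : E) ε ⊆ Φ.source) (hg : g.IsRiemannian)
    (hgauss : ∀ x w : E, g.val (f x) (mfderiv 𝓘(ℝ, E) I f x w) (mfderiv 𝓘(ℝ, E) I f x x) =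
      g.val p w x)
    {x₀ : E} (hx₀ : x₀ ∈ f ⁻¹' (Φ '' ball (0 : E) ε)) {a : E} {R₀ : ℝ} (hR₀ : R₀ < ε)
    (hseg : ∀ t ∈ Icc (0 : ℝ) 1, Φ.toPartialEquiv.symm (f x₀) + t • a ∈ closedBall (0 : E) R₀)
    {L : ℝ} (hL : 0 ≤ L)
    (hspeed : ∀ t ∈ Icc (0 : ℝ) 1, g.val (Φ (Φ.toPartialEquiv.symm (f x₀) + t • a))
      (velocity I (fun t : ℝ ↦ Φ (Φ.toPartialEquiv.symm (f x₀) + t • a)) t)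
      (velocity I (fun t : ℝ ↦ Φ (Φ.toPartialEquiv.symm (f x₀) + t • a)) t) ≤ L ^ 2) :
    ∃ X : ℝ → E, X 0 = x₀ ∧
      (∀ t ∈ Icc (0 : ℝ) 1, HasDerivWithinAt X
        ((fderiv ℝ (fun x : E ↦ Φ.toPartialEquiv.symm (f x)) (X t)).inverse a) (Icc 0 1) t) ∧
      ∀ t ∈ Icc (0 : ℝ) 1, X t ∈ f ⁻¹' (Φ '' ball (0 : E) ε) ∧
        Φ.toPartialEquiv.symm (f (X t)) = Φ.toPartialEquiv.symm (f x₀) + t • a := by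
  have hO := isOpen_preimage_image_ball Φ hπs.continuous hε
  set Ω : Set E := f ⁻¹' (Φ '' ball (0 : E) ε) with hΩ
  set ψ : E → E := fun x ↦ Φ.toPartialEquiv.symm (f x) with hψ
  set G : E → E := fun x ↦ (fderiv ℝ ψ x).inverse a with hG
  set b : E := ψ x₀ with hb
  have hpos : ∀ (x : M) (v : TangentSpace I x), 0 ≤ g.val x v v := fun x v ↦ by
    by_cases hv : v = 0
    · simp [hv]
    · exact (hg x v hv).le
  -- consequences for a solution on `[0, s]`, `s ≤ 1`
  have hprop : ∀ s ∈ Icc (0 : ℝ) 1, ∀ X : ℝ → E, X 0 = x₀ →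
      (∀ t ∈ Icc 0 s, HasDerivWithinAt X (G (X t)) (Icc 0 s) t) →
      ∀ t ∈ Icc 0 s, X t ∈ Ω ∧ ψ (X t) = b + t • a ∧ f (X t) = Φ (b + t • a) := by
    intro s hs X hX0 hX
    have hseg' : ∀ t ∈ Icc (0 : ℝ) 1, ψ (X 0) + t • a ∈ closedBall (0 : E) R₀ := by
      rw [hX0]; exact hseg
    have hmem := liftChart_solution_mem Φ hπs hπ hε hs.2 hR₀ hX (by rw [hX0]; exact hx₀) hseg'
    have hline := liftChart_solution_eq Φ hπs hπ hε hX hmem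
    intro t ht
    have h2 : ψ (X t) = b + t • a := by
      show Φ.toPartialEquiv.symm (f (X t)) = Φ.toPartialEquiv.symm (f x₀) + t • a
      rw [hline t ht, hX0]
    refine ⟨hmem t ht, h2, ?_⟩
    have h3 := (liftChart_mem_ball Φ hε (hmem t ht)).2.1
    rw [← h3]
    exact congrArg Φ h2
  -- the a priori bound on the norm
  obtain ⟨c, hc, hcg⟩ := exists_pos_mul_norm_sq_le_val_point g hg p
  set R₁ : ℝ := (g.val p x₀ x₀ + L ^ 2) * Real.exp 1 with hR₁
  have hR₁0 : 0 ≤ R₁ := by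
    have := hpos p x₀
    positivity
  set R : ℝ := Real.sqrt (R₁ / c) with hR
  set K : Set E := closedBall (0 : E) R ∩ f ⁻¹' (Φ '' closedBall (0 : E) R₀) with hK
  have hKc : IsCompact K := by
    refine (isCompact_closedBall (0 : E) R).inter_right ?_
    refine IsClosed.preimage hπs.continuous (IsCompact.isClosed ?_)
    exact (isCompact_closedBall (0 : E) R₀).image_of_continuousOn
      (Φ.contMDiffOn.continuousOn.mono ((closedBall_subset_closedBall hR₀.le).trans hε))
  have hKΩ : K ⊆ Ω := by
    rintro x ⟨-, v, hv, hvx⟩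
    exact ⟨v, (closedBall_subset_ball hR₀) hv, hvx⟩
  have hconf : ∀ s ∈ Icc (0 : ℝ) 1, ∀ X : ℝ → E, X 0 = x₀ →
      (∀ t ∈ Icc 0 s, HasDerivWithinAt X (G (X t)) (Icc 0 s) t) → ∀ t ∈ Icc 0 s, X t ∈ K := by
    intro s hs X hX0 hX t ht
    have hP := hprop s hs X hX0 hX
    refine ⟨?_, b + t • a, hseg t ⟨ht.1, ht.2.trans hs.2⟩, (hP t ht).2.2.symm⟩
    -- norm bound from the Gauss bound
    have hval := val_solution_le Φ g hπs hπ hε hpos hgauss hL hX (fun t ht ↦ (hP t ht).1)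
      (fun t ht ↦ (hP t ht).2.2) hspeed hs.2 t ht
    rw [hX0] at hval
    have h1 : c * ‖X t‖ ^ 2 ≤ R₁ := (hcg (X t)).trans hval
    rw [mem_closedBall, dist_zero_right, hR]
    refine Real.le_sqrt_of_sq_le ?_
    rwa [le_div_iff₀ hc, mul_comm]
  -- global existence on `[0, 1]`
  have hGs : ContDiffOn ℝ 1 G Ω := (contDiffOn_liftField Φ hπs hπ hε a).of_le (by simp)
  obtain ⟨X, hX0, hX⟩ := Literature.Analysis.ODE.exists_solution_of_confined hO hGs hKc hKΩ
    (x₀ := x₀) zero_le_one hconf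
  refine ⟨X, hX0, hX, fun t ht ↦ ?_⟩
  have hP := hprop 1 ⟨zero_le_one, le_rfl⟩ X hX0 hX t ht
  exact ⟨hP.1, hP.2.1⟩

end LiftExistence

/-! ### Uniqueness and reversal of lifts -/

section LiftUnique

variable {f : E → M} (Φ : PartialDiffeomorph 𝓘(ℝ, E) I E M ∞) {ε : ℝ}

omit [IsManifold I ∞ M] in
/-- **Uniqueness of lifts**: two solutions of the lifting equation `X' = (Dψ_X)⁻¹ a` within
`[0, T]` staying in `Ω` and starting at the same point coincide on `[0, T]` (the field is `C¹` on
`Ω`, hence Lipschitz on the compact union of the two orbits;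
Mathlib's `ODE_solution_unique_of_mem_Icc_right`). [folklore] -/
theorem liftChart_solution_unique [CompleteSpace E] [FiniteDimensional ℝ E]
    (hπs : ContMDiff 𝓘(ℝ, E) I ∞ f) (hπ : IsLocalDiffeomorph 𝓘(ℝ, E) I ∞ f)
    (hε : closedBall (0 : E) ε ⊆ Φ.source) {a : E} {X Y : ℝ → E} {T : ℝ}
    (hX : ∀ t ∈ Icc 0 T, HasDerivWithinAt X
      ((fderiv ℝ (fun x : E ↦ Φ.toPartialEquiv.symm (f x)) (X t)).inverse a) (Icc 0 T) t)
    (hY : ∀ t ∈ Icc 0 T, HasDerivWithinAt Y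
      ((fderiv ℝ (fun x : E ↦ Φ.toPartialEquiv.symm (f x)) (Y t)).inverse a) (Icc 0 T) t)
    (hXΩ : ∀ t ∈ Icc 0 T, X t ∈ f ⁻¹' (Φ '' ball (0 : E) ε))
    (hYΩ : ∀ t ∈ Icc 0 T, Y t ∈ f ⁻¹' (Φ '' ball (0 : E) ε)) (h0 : X 0 = Y 0) :
    EqOn X Y (Icc 0 T) := by
  have hO := isOpen_preimage_image_ball Φ hπs.continuous hε
  set G : E → E := fun x ↦ (fderiv ℝ (fun x : E ↦ Φ.toPartialEquiv.symm (f x)) x).inverse a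
    with hG
  have hGs : ContDiffOn ℝ 1 G (f ⁻¹' (Φ '' ball (0 : E) ε)) :=
    (contDiffOn_liftField Φ hπs hπ hε a).of_le (by simp)
  have hXc : ContinuousOn X (Icc 0 T) := fun t ht ↦ (hX t ht).continuousWithinAt
  have hYc : ContinuousOn Y (Icc 0 T) := fun t ht ↦ (hY t ht).continuousWithinAt
  set K : Set E := X '' Icc 0 T ∪ Y '' Icc 0 T with hK
  have hKc : IsCompact K :=
    (isCompact_Icc.image_of_continuousOn hXc).union (isCompact_Icc.image_of_continuousOn hYc)
  have hKΩ : K ⊆ f ⁻¹' (Φ '' ball (0 : E) ε) := by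
    rintro x (⟨t, ht, rfl⟩ | ⟨t, ht, rfl⟩)
    · exact hXΩ t ht
    · exact hYΩ t ht
  obtain ⟨C, hC⟩ := Literature.Analysis.ODE.exists_lipschitzOnWith_of_isCompact hO hGs hKc hKΩ
  refine ODE_solution_unique_of_mem_Icc_right (v := fun _ ↦ G) (s := fun _ ↦ K) (K := C)
    (fun _ _ ↦ hC) hXc (fun t ht ↦ ?_) (fun t ht ↦ Or.inl ⟨t, Ico_subset_Icc_self ht, rfl⟩) hYc
    (fun t ht ↦ ?_) (fun t ht ↦ Or.inr ⟨t, Ico_subset_Icc_self ht, rfl⟩) h0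
  · exact (hX t (Ico_subset_Icc_self ht)).mono_of_mem_nhdsWithin
      (mem_of_superset (Icc_mem_nhdsGE ht.2) (Icc_subset_Icc_left ht.1))
  · exact (hY t (Ico_subset_Icc_self ht)).mono_of_mem_nhdsWithin
      (mem_of_superset (Icc_mem_nhdsGE ht.2) (Icc_subset_Icc_left ht.1))

omit [IsManifold I ∞ M] in
/-- **Reversal of lifts**: if `Y` solves the lifting equation with parameter `a` within `[0, 1]`,
then `t ↦ Y (1 - t)` solves it with parameter `-a` (the field is linear in the parameter).
[folklore] -/
theorem liftChart_solution_reverse {a : E} {Y : ℝ → E}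
    (hY : ∀ t ∈ Icc (0 : ℝ) 1, HasDerivWithinAt Y
      ((fderiv ℝ (fun x : E ↦ Φ.toPartialEquiv.symm (f x)) (Y t)).inverse a) (Icc 0 1) t) :
    ∀ t ∈ Icc (0 : ℝ) 1, HasDerivWithinAt (fun t ↦ Y (1 - t))
      ((fderiv ℝ (fun x : E ↦ Φ.toPartialEquiv.symm (f x)) (Y (1 - t))).inverse (-a))
      (Icc 0 1) t := by
  intro t ht
  have h1t : 1 - t ∈ Icc (0 : ℝ) 1 := ⟨by linarith [ht.2], by linarith [ht.1]⟩
  have hmaps : MapsTo (fun t : ℝ ↦ 1 - t) (Icc (0 : ℝ) 1) (Icc (0 : ℝ) 1) := fun s hs ↦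
    ⟨by linarith [hs.2], by linarith [hs.1]⟩
  have hφ : HasDerivWithinAt (fun t : ℝ ↦ 1 - t) (-1) (Icc (0 : ℝ) 1) t := by
    simpa using ((hasDerivAt_id t).const_sub (1 : ℝ)).hasDerivWithinAt
  have h := (hY (1 - t) h1t).scomp t hφ hmaps
  rw [neg_one_smul] at h
  rw [map_neg]
  exact h

end LiftUnique

/-! ### Inward and outward lifts over a chart ball; continuity of the inward endpoint -/

section InOut

open Literature.Geometry.Lorentzian

variable {f : E → M} (Φ : PartialDiffeomorph 𝓘(ℝ, E) I E M ∞) {ε : ℝ} {n : ℕ∞ω}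
  (g : PseudoRiemannianMetric I n E (TangentSpace I : M → Type _)) {p : M}

omit [IsManifold I ∞ M] in
/-- The operator family `x ↦ (Dψ_x)⁻¹` is continuous on `Ω`. [folklore] -/
theorem continuousOn_inverse_fderiv_liftChart [CompleteSpace E] (hπs : ContMDiff 𝓘(ℝ, E) I ∞ f)
    (hπ : IsLocalDiffeomorph 𝓘(ℝ, E) I ∞ f) (hε : closedBall (0 : E) ε ⊆ Φ.source) :
    ContinuousOn (fun x : E ↦ (fderiv ℝ (fun x : E ↦ Φ.toPartialEquiv.symm (f x)) x).inverse)
      (f ⁻¹' (Φ '' ball (0 : E) ε)) := by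
  have hO := isOpen_preimage_image_ball Φ hπs.continuous hε
  have hD : ContinuousOn (fderiv ℝ (fun x : E ↦ Φ.toPartialEquiv.symm (f x)))
      (f ⁻¹' (Φ '' ball (0 : E) ε)) :=
    (contDiffOn_liftChart Φ hπs hε).continuousOn_fderiv_of_isOpen hO (by simp)
  intro x hx
  obtain ⟨e, he⟩ := exists_continuousLinearEquiv_fderiv_liftChart Φ hπs hπ hε hx
  have hinv : ContinuousAt (ContinuousLinearMap.inverse : (E →L[ℝ] E) → E →L[ℝ] E)
      (fderiv ℝ (fun x : E ↦ Φ.toPartialEquiv.symm (f x)) x) := by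
    rw [← he]; exact (contDiffAt_map_inverse (n := 1) e).continuousAt
  exact hinv.comp_continuousWithinAt (hD x hx)

/-- **Inward lifts exist.** Under the hypotheses of `exists_lift_of_segment`, with the speed of
the inward chart rays `t ↦ Φ((1 - t) b)` bounded by `C_q ‖b‖²`, every `x̃ ∈ Ω` is the initial
point of a solution on `[0, 1]` of the lifting equation with parameter `-ψ x̃`, staying in `Ω`,
along which `ψ` decreases linearly to `0`: `ψ (X t) = (1 - t) ψ x̃`; in particular
`f (X 1) = Φ 0`. [cite: LeeRiemannianManifolds2018, Thm. 6.23 (proof)] -/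
theorem exists_inward_lift [T2Space M] [CompleteSpace E] [FiniteDimensional ℝ E]
    (hπs : ContMDiff 𝓘(ℝ, E) I ∞ f) (hπ : IsLocalDiffeomorph 𝓘(ℝ, E) I ∞ f)
    (hε : closedBall (0 : E) ε ⊆ Φ.source) (hg : g.IsRiemannian)
    (hgauss : ∀ x w : E, g.val (f x) (mfderiv 𝓘(ℝ, E) I f x w) (mfderiv 𝓘(ℝ, E) I f x x) =
      g.val p w x)
    {Cq : ℝ} (hCq : 0 ≤ Cq)
    (hspeedIn : ∀ b ∈ ball (0 : E) ε, ∀ t ∈ Icc (0 : ℝ) 1,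
      g.val (Φ (b + t • (-b))) (velocity I (fun t : ℝ ↦ Φ (b + t • (-b))) t)
        (velocity I (fun t : ℝ ↦ Φ (b + t • (-b))) t) ≤ Cq * ‖b‖ ^ 2)
    {x₀ : E} (hx₀ : x₀ ∈ f ⁻¹' (Φ '' ball (0 : E) ε)) :
    ∃ X : ℝ → E, X 0 = x₀ ∧
      (∀ t ∈ Icc (0 : ℝ) 1, HasDerivWithinAt X
        ((fderiv ℝ (fun x : E ↦ Φ.toPartialEquiv.symm (f x)) (X t)).inverse
          (-Φ.toPartialEquiv.symm (f x₀))) (Icc 0 1) t) ∧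
      ∀ t ∈ Icc (0 : ℝ) 1, X t ∈ f ⁻¹' (Φ '' ball (0 : E) ε) ∧
        Φ.toPartialEquiv.symm (f (X t)) = (1 - t) • Φ.toPartialEquiv.symm (f x₀) := by
  set b : E := Φ.toPartialEquiv.symm (f x₀) with hb
  have hbε : b ∈ ball (0 : E) ε := (liftChart_mem_ball Φ hε hx₀).1
  have hbn : ‖b‖ < ε := by simpa using hbε
  have hray : ∀ t : ℝ, b + t • (-b) = (1 - t) • b := fun t ↦ by
    rw [sub_smul, one_smul, smul_neg, sub_eq_add_neg]
  have hseg : ∀ t ∈ Icc (0 : ℝ) 1, b + t • (-b) ∈ closedBall (0 : E) ‖b‖ := by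
    intro t ht
    rw [hray t, mem_closedBall, dist_zero_right, norm_smul, Real.norm_eq_abs,
      abs_of_nonneg (by linarith [ht.2])]
    exact mul_le_of_le_one_left (norm_nonneg _) (by linarith [ht.1])
  set L : ℝ := Real.sqrt Cq * ‖b‖ with hL
  have hL0 : 0 ≤ L := by positivity
  have hL2 : L ^ 2 = Cq * ‖b‖ ^ 2 := by rw [hL, mul_pow, Real.sq_sqrt hCq]
  have hspeed : ∀ t ∈ Icc (0 : ℝ) 1, g.val (Φ (b + t • (-b)))
      (velocity I (fun t : ℝ ↦ Φ (b + t • (-b))) t)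
      (velocity I (fun t : ℝ ↦ Φ (b + t • (-b))) t) ≤ L ^ 2 := fun t ht ↦ by
    rw [hL2]; exact hspeedIn b hbε t ht
  obtain ⟨X, hX0, hX, hXprop⟩ := exists_lift_of_segment Φ g hπs hπ hε hg hgauss hx₀ hbn hseg hL0 hspeed
  refine ⟨X, hX0, hX, fun t ht ↦ ⟨(hXprop t ht).1, ?_⟩⟩
  rw [(hXprop t ht).2]
  exact hray t

/-- **Outward lifts exist.** With the speed of the outward chart rays `t ↦ Φ(t u)` bounded by
`C_q ‖u‖²`, every point `q̃` of the fibre over the centre (`f q̃ = Φ 0`) is the initial point of a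
solution on `[0, 1]` of the lifting equation with parameter `u ∈ B_ε`, staying in `Ω`, with
`ψ (Y t) = t u`; in particular `f (Y 1) = Φ u`. [cite: LeeRiemannianManifolds2018, Thm. 6.23 (proof)] -/
theorem exists_outward_lift [T2Space M] [CompleteSpace E] [FiniteDimensional ℝ E]
    (hπs : ContMDiff 𝓘(ℝ, E) I ∞ f) (hπ : IsLocalDiffeomorph 𝓘(ℝ, E) I ∞ f)
    (hε : closedBall (0 : E) ε ⊆ Φ.source) (hg : g.IsRiemannian)
    (hgauss : ∀ x w : E, g.val (f x) (mfderiv 𝓘(ℝ, E) I f x w) (mfderiv 𝓘(ℝ, E) I f x x) =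
      g.val p w x)
    {Cq : ℝ} (hCq : 0 ≤ Cq)
    (hspeedOut : ∀ u ∈ ball (0 : E) ε, ∀ t ∈ Icc (0 : ℝ) 1,
      g.val (Φ ((0 : E) + t • u)) (velocity I (fun t : ℝ ↦ Φ ((0 : E) + t • u)) t)
        (velocity I (fun t : ℝ ↦ Φ ((0 : E) + t • u)) t) ≤ Cq * ‖u‖ ^ 2)
    {q₀ : E} (hq₀ : f q₀ = Φ 0) (hΦ0 : (0 : E) ∈ Φ.source) (hε0 : 0 < ε)
    {u : E} (hu : u ∈ ball (0 : E) ε) :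
    ∃ Y : ℝ → E, Y 0 = q₀ ∧
      (∀ t ∈ Icc (0 : ℝ) 1, HasDerivWithinAt Y
        ((fderiv ℝ (fun x : E ↦ Φ.toPartialEquiv.symm (f x)) (Y t)).inverse u) (Icc 0 1) t) ∧
      ∀ t ∈ Icc (0 : ℝ) 1, Y t ∈ f ⁻¹' (Φ '' ball (0 : E) ε) ∧
        Φ.toPartialEquiv.symm (f (Y t)) = t • u := by
  have hq₀Ω : q₀ ∈ f ⁻¹' (Φ '' ball (0 : E) ε) := ⟨0, mem_ball_self hε0, hq₀.symm⟩
  have hψ0 : Φ.toPartialEquiv.symm (f q₀) = 0 := by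
    rw [hq₀]; exact Φ.toPartialEquiv.left_inv hΦ0
  have hun : ‖u‖ < ε := by simpa using hu
  have hseg : ∀ t ∈ Icc (0 : ℝ) 1, Φ.toPartialEquiv.symm (f q₀) + t • u ∈ closedBall (0 : E) ‖u‖ := by
    intro t ht
    rw [hψ0, zero_add, mem_closedBall, dist_zero_right, norm_smul, Real.norm_eq_abs,
      abs_of_nonneg ht.1]
    exact mul_le_of_le_one_left (norm_nonneg _) ht.2
  set L : ℝ := Real.sqrt Cq * ‖u‖ with hL
  have hL0 : 0 ≤ L := by positivity
  have hL2 : L ^ 2 = Cq * ‖u‖ ^ 2 := by rw [hL, mul_pow, Real.sq_sqrt hCq]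
  have hspeed : ∀ t ∈ Icc (0 : ℝ) 1, g.val (Φ (Φ.toPartialEquiv.symm (f q₀) + t • u))
      (velocity I (fun t : ℝ ↦ Φ (Φ.toPartialEquiv.symm (f q₀) + t • u)) t)
      (velocity I (fun t : ℝ ↦ Φ (Φ.toPartialEquiv.symm (f q₀) + t • u)) t) ≤ L ^ 2 := by
    intro t ht
    rw [hψ0, hL2]
    exact hspeedOut u hu t ht
  obtain ⟨Y, hY0, hY, hYprop⟩ := exists_lift_of_segment Φ g hπs hπ hε hg hgauss hq₀Ω hun hseg hL0 hspeed
  refine ⟨Y, hY0, hY, fun t ht ↦ ⟨(hYprop t ht).1, ?_⟩⟩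
  rw [(hYprop t ht).2, hψ0, zero_add]

end InOut

/-! ### Continuity of the inward endpoint (Gronwall) -/

section Endpoint

open Literature.Geometry.Lorentzian

variable {f : E → M} (Φ : PartialDiffeomorph 𝓘(ℝ, E) I E M ∞) {ε : ℝ} {n : ℕ∞ω}
  (g : PseudoRiemannianMetric I n E (TangentSpace I : M → Type _)) {p : M}

omit [IsManifold I ∞ M] in
/-- An elementary bound for the Grönwall function at time `1`:
`gronwallBound δ C e 1 ≤ (δ + e) exp C` for `e, C ≥ 0` (from `exp C - 1 ≤ C exp C`).
[folklore] -/
theorem gronwallBound_one_le {δ C e : ℝ} (hC : 0 ≤ C) (he : 0 ≤ e) :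
    gronwallBound δ C e 1 ≤ (δ + e) * Real.exp C := by
  rcases hC.eq_or_lt with h0 | hpos
  · rw [← h0, gronwallBound_K0]
    simp
  · rw [gronwallBound_of_K_ne_0 hpos.ne']
    simp only [mul_one]
    have h1 : Real.exp C - 1 ≤ C * Real.exp C := by
      have h2 := Real.add_one_le_exp (-C)
      have h3 : Real.exp (-C) * Real.exp C = 1 := by rw [← Real.exp_add]; simp
      nlinarith [Real.exp_pos C, Real.exp_pos (-C)]
    have h4 : e / C * (Real.exp C - 1) ≤ e * Real.exp C := by
      rw [div_mul_eq_mul_div, div_le_iff₀ hpos]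
      calc e * (Real.exp C - 1) ≤ e * (C * Real.exp C) := mul_le_mul_of_nonneg_left h1 he
        _ = e * Real.exp C * C := by ring
    nlinarith [h4]

/-- **The endpoint of the inward lift depends continuously on the initial point.** In the
setting of `exists_inward_lift`, for `x₀ ∈ Ω` and `η > 0` there is `δ > 0` such that for every
`x₁ ∈ Ω` with `dist x₁ x₀ < δ`, any inward lifts `X₀` from `x₀` and `X₁` from `x₁` (solutions on
`[0, 1]` of the lifting equation with parameters `-ψ x₀`, `-ψ x₁`) end within distance `η`:
`dist (X₁ 1) (X₀ 1) < η`. Proof: all inward lifts from points near `x₀` lie in one compact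
`K' ⊆ Ω` (the a priori bound `val_solution_le` is locally uniform), on which the field with
parameter `-ψ x₀` is Lipschitz and the fields differ by at most `N ‖ψ x₁ - ψ x₀‖`; Grönwall's
inequality for approximate trajectories (Mathlib's `dist_le_of_approx_trajectories_ODE_of_mem`).
[folklore] -/
theorem inward_lift_endpoint_near [T2Space M] [CompleteSpace E] [FiniteDimensional ℝ E]
    (hπs : ContMDiff 𝓘(ℝ, E) I ∞ f) (hπ : IsLocalDiffeomorph 𝓘(ℝ, E) I ∞ f)
    (hε : closedBall (0 : E) ε ⊆ Φ.source) (hg : g.IsRiemannian)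
    (hgauss : ∀ x w : E, g.val (f x) (mfderiv 𝓘(ℝ, E) I f x w) (mfderiv 𝓘(ℝ, E) I f x x) =
      g.val p w x)
    {Cq : ℝ} (hCq : 0 ≤ Cq)
    (hspeedIn : ∀ b ∈ ball (0 : E) ε, ∀ t ∈ Icc (0 : ℝ) 1,
      g.val (Φ (b + t • (-b))) (velocity I (fun t : ℝ ↦ Φ (b + t • (-b))) t)
        (velocity I (fun t : ℝ ↦ Φ (b + t • (-b))) t) ≤ Cq * ‖b‖ ^ 2)
    {x₀ : E} (hx₀ : x₀ ∈ f ⁻¹' (Φ '' ball (0 : E) ε)) {η : ℝ} (hη : 0 < η) :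
    ∃ δ > (0 : ℝ), ∀ x₁ ∈ f ⁻¹' (Φ '' ball (0 : E) ε), dist x₁ x₀ < δ →
      ∀ X₀ X₁ : ℝ → E, X₀ 0 = x₀ → X₁ 0 = x₁ →
        (∀ t ∈ Icc (0 : ℝ) 1, HasDerivWithinAt X₀
          ((fderiv ℝ (fun x : E ↦ Φ.toPartialEquiv.symm (f x)) (X₀ t)).inverse
            (-Φ.toPartialEquiv.symm (f x₀))) (Icc 0 1) t) →
        (∀ t ∈ Icc (0 : ℝ) 1, HasDerivWithinAt X₁
          ((fderiv ℝ (fun x : E ↦ Φ.toPartialEquiv.symm (f x)) (X₁ t)).inverse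
            (-Φ.toPartialEquiv.symm (f x₁))) (Icc 0 1) t) →
        dist (X₁ 1) (X₀ 1) < η := by
  have hO := isOpen_preimage_image_ball Φ hπs.continuous hε
  set Ω : Set E := f ⁻¹' (Φ '' ball (0 : E) ε) with hΩ
  set ψ : E → E := fun x ↦ Φ.toPartialEquiv.symm (f x) with hψ
  set B : E →L[ℝ] E →L[ℝ] ℝ := g.val p with hB
  have hpos : ∀ (x : M) (v : TangentSpace I x), 0 ≤ g.val x v v := fun x v ↦ by
    by_cases hv : v = 0
    · simp [hv]
    · exact (hg x v hv).le
  have hψc : ContinuousAt ψ x₀ := (contDiffOn_liftChart Φ hπs hε).continuousOn.continuousAt (hO.mem_nhds hx₀)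
  have hBc : Continuous fun x : E ↦ B x x := B.continuous₂.comp (continuous_id.prodMk continuous_id)
  -- the radius margin
  have hb₀ : ‖ψ x₀‖ < ε := by simpa using (liftChart_mem_ball Φ hε hx₀).1
  set R₀ : ℝ := (‖ψ x₀‖ + ε) / 2 with hR₀
  have hR₀ε : R₀ < ε := by rw [hR₀]; linarith
  have hR₀b : ‖ψ x₀‖ < R₀ := by rw [hR₀]; linarith
  have hR₀0 : 0 ≤ R₀ := le_trans (norm_nonneg _) hR₀b.le
  -- a ball around `x₀` inside `Ω` on which `‖ψ‖ < R₀` and `B x x < B x₀ x₀ + 1`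
  obtain ⟨δ₁, hδ₁, hball⟩ : ∃ δ₁ > (0 : ℝ), ∀ x, dist x x₀ < δ₁ →
      x ∈ Ω ∧ ‖ψ x‖ < R₀ ∧ B x x < B x₀ x₀ + 1 := by
    have h1 : ∀ᶠ x in 𝓝 x₀, x ∈ Ω := hO.mem_nhds hx₀
    have h2 : ∀ᶠ x in 𝓝 x₀, ‖ψ x‖ < R₀ :=
      (continuous_norm.continuousAt.comp hψc).eventually (gt_mem_nhds hR₀b)
    have h3 : ∀ᶠ x in 𝓝 x₀, B x x < B x₀ x₀ + 1 :=
      hBc.continuousAt.eventually (gt_mem_nhds (by linarith))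
    obtain ⟨δ₁, hδ₁, h⟩ := Metric.eventually_nhds_iff.1 (h1.and (h2.and h3))
    exact ⟨δ₁, hδ₁, fun x hx ↦ h hx⟩
  -- the uniform compact set
  obtain ⟨c, hc, hcg⟩ := exists_pos_mul_norm_sq_le_val_point g hg p
  set R₁ : ℝ := (B x₀ x₀ + 1 + Cq * R₀ ^ 2) * Real.exp 1 with hR₁
  have hBx₀ : 0 ≤ B x₀ x₀ := hpos p x₀
  have hR₁0 : 0 ≤ R₁ := by positivity
  set R : ℝ := Real.sqrt (R₁ / c) with hR
  set K : Set E := closedBall (0 : E) R ∩ f ⁻¹' (Φ '' closedBall (0 : E) R₀) with hK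
  have hKc : IsCompact K := by
    refine (isCompact_closedBall (0 : E) R).inter_right ?_
    refine IsClosed.preimage hπs.continuous (IsCompact.isClosed ?_)
    exact (isCompact_closedBall (0 : E) R₀).image_of_continuousOn
      (Φ.contMDiffOn.continuousOn.mono ((closedBall_subset_closedBall hR₀ε.le).trans hε))
  have hKΩ : K ⊆ Ω := by
    rintro x ⟨-, v, hv, hvx⟩
    exact ⟨v, (closedBall_subset_ball hR₀ε) hv, hvx⟩
  -- every inward lift from the ball stays in `K` (and in `Ω`)
  have hstay : ∀ x₁, dist x₁ x₀ < δ₁ → ∀ X : ℝ → E, X 0 = x₁ →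
      (∀ t ∈ Icc (0 : ℝ) 1, HasDerivWithinAt X ((fderiv ℝ ψ (X t)).inverse (-ψ x₁)) (Icc 0 1) t) →
      ∀ t ∈ Icc (0 : ℝ) 1, X t ∈ Ω ∧ X t ∈ K := by
    intro x₁ hx₁ X hX0 hX
    obtain ⟨hx₁Ω, hψx₁, hBx₁⟩ := hball x₁ hx₁
    have hray : ∀ t : ℝ, ψ x₁ + t • (-ψ x₁) = (1 - t) • ψ x₁ := fun t ↦ by
      rw [sub_smul, one_smul, smul_neg, sub_eq_add_neg]
    have hseg : ∀ t ∈ Icc (0 : ℝ) 1, ψ (X 0) + t • (-ψ x₁) ∈ closedBall (0 : E) ‖ψ x₁‖ := by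
      intro t ht
      rw [hX0, hray t, mem_closedBall, dist_zero_right, norm_smul, Real.norm_eq_abs,
        abs_of_nonneg (by linarith [ht.2])]
      exact mul_le_of_le_one_left (norm_nonneg _) (by linarith [ht.1])
    have hψx₁ε : ‖ψ x₁‖ < ε := hψx₁.trans hR₀ε
    have hmem := liftChart_solution_mem Φ hπs hπ hε le_rfl hψx₁ε hX (by rw [hX0]; exact hx₁Ω) hseg
    have hline := liftChart_solution_eq Φ hπs hπ hε hX hmem
    have hfX : ∀ t ∈ Icc (0 : ℝ) 1, f (X t) = Φ (ψ x₁ + t • (-ψ x₁)) := by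
      intro t ht
      have h3 := (liftChart_mem_ball Φ hε (hmem t ht)).2.1
      rw [← h3, hline t ht, hX0]
    -- the Gauss bound
    set L : ℝ := Real.sqrt Cq * ‖ψ x₁‖ with hL
    have hL0 : 0 ≤ L := by positivity
    have hL2 : L ^ 2 = Cq * ‖ψ x₁‖ ^ 2 := by rw [hL, mul_pow, Real.sq_sqrt hCq]
    have hspeed : ∀ t ∈ Icc (0 : ℝ) 1, g.val (Φ (ψ x₁ + t • (-ψ x₁)))
        (velocity I (fun t : ℝ ↦ Φ (ψ x₁ + t • (-ψ x₁))) t)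
        (velocity I (fun t : ℝ ↦ Φ (ψ x₁ + t • (-ψ x₁))) t) ≤ L ^ 2 := fun t ht ↦ by
      rw [hL2]; exact hspeedIn (ψ x₁) (by simpa using hψx₁ε) t ht
    have hval := val_solution_le Φ g hπs hπ hε hpos hgauss hL0 hX (fun t ht ↦ hmem t ht) hfX
      hspeed le_rfl
    intro t ht
    refine ⟨hmem t ht, ?_, ψ x₁ + t • (-ψ x₁), ?_, (hfX t ht).symm⟩
    · -- norm bound
      have h1 := hval t ht
      rw [hX0] at h1
      have h2 : g.val p (X t) (X t) ≤ R₁ := by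
        refine h1.trans ?_
        rw [hR₁]
        refine mul_le_mul_of_nonneg_right ?_ (Real.exp_pos 1).le
        have h5 : L ^ 2 ≤ Cq * R₀ ^ 2 := by
          rw [hL2]
          exact mul_le_mul_of_nonneg_left (by nlinarith [norm_nonneg (ψ x₁)]) hCq
        change B x₁ x₁ + L ^ 2 ≤ B x₀ x₀ + 1 + Cq * R₀ ^ 2
        linarith
      have h3 : c * ‖X t‖ ^ 2 ≤ R₁ := (hcg (X t)).trans h2
      rw [mem_closedBall, dist_zero_right, hR]
      refine Real.le_sqrt_of_sq_le ?_
      rwa [le_div_iff₀ hc, mul_comm]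
    · rw [hray t, mem_closedBall, dist_zero_right, norm_smul, Real.norm_eq_abs,
        abs_of_nonneg (by linarith [ht.2])]
      exact (mul_le_of_le_one_left (norm_nonneg _) (by linarith [ht.1])).trans hψx₁.le
  -- Lipschitz constant of the reference field and bound of `(Dψ)⁻¹` on `K`
  set G₀ : E → E := fun x ↦ (fderiv ℝ ψ x).inverse (-ψ x₀) with hG₀
  have hG₀s : ContDiffOn ℝ 1 G₀ Ω := (contDiffOn_liftField Φ hπs hπ hε (-ψ x₀)).of_le (by simp)
  obtain ⟨C, hC⟩ := Literature.Analysis.ODE.exists_lipschitzOnWith_of_isCompact hO hG₀s hKc hKΩ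
  obtain ⟨N, hN⟩ := hKc.exists_bound_of_continuousOn
    ((continuousOn_inverse_fderiv_liftChart Φ hπs hπ hε).mono hKΩ)
  set N' : ℝ := max N 1 with hN'
  have hN'0 : 0 < N' := lt_of_lt_of_le one_pos (le_max_right _ _)
  have hNN' : N ≤ N' := le_max_left _ _
  have heC : 0 < Real.exp C := Real.exp_pos C
  -- smallness of `ψ x₁ - ψ x₀`
  obtain ⟨δ₂, hδ₂, hψδ⟩ : ∃ δ₂ > (0 : ℝ), ∀ x, dist x x₀ < δ₂ →
      ‖ψ x - ψ x₀‖ < η / (4 * N' * Real.exp C) := by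
    have hpos' : 0 < η / (4 * N' * Real.exp C) := by positivity
    have h := Metric.tendsto_nhds.1 hψc _ hpos'
    obtain ⟨δ₂, hδ₂, h'⟩ := Metric.eventually_nhds_iff.1 h
    exact ⟨δ₂, hδ₂, fun x hx ↦ by rw [← dist_eq_norm]; exact h' hx⟩
  refine ⟨min δ₁ (min δ₂ (η / (4 * Real.exp C))), by positivity, ?_⟩
  intro x₁ hx₁Ω hx₁ X₀ X₁ hX₀0 hX₁0 hX₀ hX₁
  have hx₁δ₁ : dist x₁ x₀ < δ₁ := hx₁.trans_le (min_le_left _ _)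
  have hx₁δ₂ : dist x₁ x₀ < δ₂ := hx₁.trans_le ((min_le_right _ _).trans (min_le_left _ _))
  have hx₁η : dist x₁ x₀ < η / (4 * Real.exp C) :=
    hx₁.trans_le ((min_le_right _ _).trans (min_le_right _ _))
  have hst₀ := hstay x₀ (by simp [hδ₁]) X₀ hX₀0 hX₀
  have hst₁ := hstay x₁ hx₁δ₁ X₁ hX₁0 hX₁
  have hX₀c : ContinuousOn X₀ (Icc 0 1) := fun t ht ↦ (hX₀ t ht).continuousWithinAt
  have hX₁c : ContinuousOn X₁ (Icc 0 1) := fun t ht ↦ (hX₁ t ht).continuousWithinAt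
  set εg : ℝ := N' * ‖ψ x₁ - ψ x₀‖ with hεg
  have hεg0 : 0 ≤ εg := by positivity
  have key := dist_le_of_approx_trajectories_ODE_of_mem (v := fun _ ↦ G₀) (s := fun _ ↦ K)
    (K := C) (f := X₀) (g := X₁) (f' := fun t ↦ G₀ (X₀ t))
    (g' := fun t ↦ (fderiv ℝ ψ (X₁ t)).inverse (-ψ x₁)) (εf := 0) (εg := εg)
    (δ := dist x₀ x₁) (a := 0) (b := 1) (fun _ _ ↦ hC) hX₀c (fun t ht ↦ ?_)
    (fun t _ ↦ by rw [dist_self]) (fun t ht ↦ (hst₀ t (Ico_subset_Icc_self ht)).2) hX₁c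
    (fun t ht ↦ ?_) (fun t ht ↦ ?_) (fun t ht ↦ (hst₁ t (Ico_subset_Icc_self ht)).2)
    (by rw [hX₀0, hX₁0]) 1 ⟨zero_le_one, le_rfl⟩
  · -- conclusion
    rw [sub_zero, zero_add] at key
    have h1 := key.trans (gronwallBound_one_le C.coe_nonneg hεg0)
    have h2 : εg < η / (4 * Real.exp C) := by
      rw [hεg]
      calc N' * ‖ψ x₁ - ψ x₀‖ < N' * (η / (4 * N' * Real.exp C)) :=
            mul_lt_mul_of_pos_left (hψδ x₁ hx₁δ₂) hN'0
        _ = η / (4 * Real.exp C) := by field_simp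
    have h3 : (dist x₀ x₁ + εg) * Real.exp C < η := by
      rw [dist_comm] at hx₁η
      have h4 : dist x₀ x₁ + εg < η / (4 * Real.exp C) + η / (4 * Real.exp C) :=
        add_lt_add hx₁η h2
      calc (dist x₀ x₁ + εg) * Real.exp C
          < (η / (4 * Real.exp C) + η / (4 * Real.exp C)) * Real.exp C :=
            mul_lt_mul_of_pos_right h4 heC
        _ = η / 2 := by field_simp; ring
        _ < η := by linarith
    rw [dist_comm]
    exact h1.trans_lt h3
  · exact (hX₀ t (Ico_subset_Icc_self ht)).mono_of_mem_nhdsWithin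
      (mem_of_superset (Icc_mem_nhdsGE ht.2) (Icc_subset_Icc_left ht.1))
  · exact (hX₁ t (Ico_subset_Icc_self ht)).mono_of_mem_nhdsWithin
      (mem_of_superset (Icc_mem_nhdsGE ht.2) (Icc_subset_Icc_left ht.1))
  · -- the fields differ by at most `εg` along `X₁`
    have hXK := (hst₁ t (Ico_subset_Icc_self ht)).2
    change dist ((fderiv ℝ ψ (X₁ t)).inverse (-ψ x₁)) ((fderiv ℝ ψ (X₁ t)).inverse (-ψ x₀)) ≤ εg
    rw [dist_eq_norm, ← map_sub, show -ψ x₁ - -ψ x₀ = -(ψ x₁ - ψ x₀) by abel, map_neg, norm_neg]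
    calc ‖(fderiv ℝ ψ (X₁ t)).inverse (ψ x₁ - ψ x₀)‖
        ≤ ‖(fderiv ℝ ψ (X₁ t)).inverse‖ * ‖ψ x₁ - ψ x₀‖ := ContinuousLinearMap.le_opNorm _ _
      _ ≤ N' * ‖ψ x₁ - ψ x₀‖ :=
          mul_le_mul_of_nonneg_right ((hN _ hXK).trans hNN') (norm_nonneg _)

end Endpoint

/-! ### Evenly covered normal balls -/

section Covering

open Literature.Geometry.Lorentzian

variable {f : E → M} (Φ : PartialDiffeomorph 𝓘(ℝ, E) I E M ∞) {ε : ℝ} {n : ℕ∞ω}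
  (g : PseudoRiemannianMetric I n E (TangentSpace I : M → Type _)) {p : M}

/-- **A chart ball with liftable rays is evenly covered.** Let `f : T_pM = E → M` be a `C^∞` local
diffeomorphism satisfying the Gauss relation for a Riemannian `g` (finite-dimensional `E`,
Hausdorff `M`), and `Φ` a chart with `closedBall 0 ε ⊆ Φ.source`, `ε > 0`, along whose inward
and outward rays the `g`-speed is controlled by `C_q ‖·‖²`. Then the centre `Φ 0` is evenly
covered by `f`, with evenly covered neighbourhood `U = Φ(B_ε)`: the sheets are the fibres of the
(locally constant) endpoint map `e` of the inward lifts, `f⁻¹(U) ≃ U × f⁻¹{Φ 0}` via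
`x̃ ↦ (f x̃, e x̃)` with inverse `(y, q̃) ↦` endpoint of the outward lift from `q̃` with parameter
`Φ⁻¹ y` (uniqueness and reversal of lifts identify the two constructions). This is the
"evenly covered" step of Lee 2018, Thm. 6.23, with metric balls in the total space replaced by
lifted rays. [cite: LeeRiemannianManifolds2018, Thm. 6.23 (proof)] -/
theorem isEvenlyCovered_of_liftChart [T2Space M] [CompleteSpace E] [FiniteDimensional ℝ E]
    (hπs : ContMDiff 𝓘(ℝ, E) I ∞ f) (hπ : IsLocalDiffeomorph 𝓘(ℝ, E) I ∞ f)
    (hε : closedBall (0 : E) ε ⊆ Φ.source) (hε0 : 0 < ε) (hg : g.IsRiemannian)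
    (hgauss : ∀ x w : E, g.val (f x) (mfderiv 𝓘(ℝ, E) I f x w) (mfderiv 𝓘(ℝ, E) I f x x) =
      g.val p w x)
    {Cq : ℝ} (hCq : 0 ≤ Cq)
    (hspeedIn : ∀ b ∈ ball (0 : E) ε, ∀ t ∈ Icc (0 : ℝ) 1,
      g.val (Φ (b + t • (-b))) (velocity I (fun t : ℝ ↦ Φ (b + t • (-b))) t)
        (velocity I (fun t : ℝ ↦ Φ (b + t • (-b))) t) ≤ Cq * ‖b‖ ^ 2)
    (hspeedOut : ∀ u ∈ ball (0 : E) ε, ∀ t ∈ Icc (0 : ℝ) 1,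
      g.val (Φ ((0 : E) + t • u)) (velocity I (fun t : ℝ ↦ Φ ((0 : E) + t • u)) t)
        (velocity I (fun t : ℝ ↦ Φ ((0 : E) + t • u)) t) ≤ Cq * ‖u‖ ^ 2) :
    IsEvenlyCovered f (Φ 0) (f ⁻¹' {Φ 0}) := by
  classical
  have hΦ0 : (0 : E) ∈ Φ.source := hε (mem_closedBall_self hε0.le)
  have hO := isOpen_preimage_image_ball Φ hπs.continuous hε
  set U : Set M := Φ '' ball (0 : E) ε with hU
  set Ω : Set E := f ⁻¹' U with hΩ
  set ψ : E → E := fun x ↦ Φ.toPartialEquiv.symm (f x) with hψ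
  have hUo : IsOpen U := Φ.toOpenPartialHomeomorph.isOpen_image_of_subset_source isOpen_ball
    (ball_subset_closedBall.trans hε)
  have hqU : Φ 0 ∈ U := ⟨0, mem_ball_self hε0, rfl⟩
  have hopen : IsOpenMap f := (hπ.isLocalHomeomorph).isOpenMap
  -- points of `U` in the chart
  have hUsymm : ∀ y ∈ U, Φ.toPartialEquiv.symm y ∈ ball (0 : E) ε ∧ Φ (Φ.toPartialEquiv.symm y) = y := by
    rintro y ⟨v, hv, rfl⟩
    have hvs : v ∈ Φ.source := hε (ball_subset_closedBall hv)
    refine ⟨by rw [Φ.toPartialEquiv.left_inv hvs]; exact hv, ?_⟩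
    show Φ.toPartialEquiv (Φ.toPartialEquiv.symm (Φ.toPartialEquiv v)) = Φ.toPartialEquiv v
    rw [Φ.toPartialEquiv.left_inv hvs]
  -- f is injective near every point
  have hinj : ∀ z : E, ∃ η > (0 : ℝ), InjOn f (ball z η) := by
    intro z
    obtain ⟨Ψ, hzΨ, heq⟩ := hπ z
    obtain ⟨η, hη, hball⟩ := Metric.isOpen_iff.1 Ψ.open_source z hzΨ
    refine ⟨η, hη, fun a ha b hb hab ↦ ?_⟩
    have h := Ψ.toPartialEquiv.injOn (hball ha) (hball hb)
    rw [← heq (hball ha), ← heq (hball hb)] at h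
    exact h hab
  -- the lifts
  have hin := fun x₀ (hx₀ : x₀ ∈ Ω) ↦ exists_inward_lift Φ g hπs hπ hε hg hgauss hCq hspeedIn hx₀
  choose! Xin hXin0 hXin hXinprop using hin
  have hout := fun q₀ (hq₀ : f q₀ = Φ 0) u (hu : u ∈ ball (0 : E) ε) ↦
    exists_outward_lift Φ g hπs hπ hε hg hgauss hCq hspeedOut hq₀ hΦ0 hε0 hu
  choose! Yout hYout0 hYout hYoutprop using hout
  set e : E → E := fun x ↦ Xin x 1 with he
  set Λ : E → E → E := fun q u ↦ Yout q u 1 with hΛ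
  have h01 : (1 : ℝ) ∈ Icc (0 : ℝ) 1 := ⟨zero_le_one, le_rfl⟩
  have h00 : (0 : ℝ) ∈ Icc (0 : ℝ) 1 := ⟨le_rfl, zero_le_one⟩
  -- basic properties of the endpoint maps
  have he_fib : ∀ x ∈ Ω, f (e x) = Φ 0 ∧ e x ∈ Ω := by
    intro x hx
    obtain ⟨hΩ1, hψ1⟩ := hXinprop x hx 1 h01
    refine ⟨?_, hΩ1⟩
    have h := (liftChart_mem_ball Φ hε hΩ1).2.1
    rw [← h]
    change Φ (ψ (Xin x 1)) = Φ 0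
    rw [show ψ (Xin x 1) = (1 - (1 : ℝ)) • ψ x from hψ1, sub_self, zero_smul]
  have hΛ_prop : ∀ q, f q = Φ 0 → ∀ u ∈ ball (0 : E) ε,
      Λ q u ∈ Ω ∧ ψ (Λ q u) = u ∧ f (Λ q u) = Φ u := by
    intro q hq u hu
    obtain ⟨hΩ1, hψ1⟩ := hYoutprop q hq u hu 1 h01
    rw [one_smul] at hψ1
    refine ⟨hΩ1, hψ1, ?_⟩
    have h := (liftChart_mem_ball Φ hε hΩ1).2.1
    rw [← h]
    exact congrArg Φ hψ1
  -- uniqueness consequences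
  have hΛe : ∀ x ∈ Ω, Λ (e x) (ψ x) = x := by
    intro x hx
    have hψx : ψ x ∈ ball (0 : E) ε := (liftChart_mem_ball Φ hε hx).1
    have hrev := liftChart_solution_reverse Φ (hXin x hx)
    rw [neg_neg] at hrev
    have hrevΩ : ∀ t ∈ Icc (0 : ℝ) 1, Xin x (1 - t) ∈ Ω := fun t ht ↦
      (hXinprop x hx (1 - t) ⟨by linarith [ht.2], by linarith [ht.1]⟩).1
    have huniq := liftChart_solution_unique Φ hπs hπ hε (hYout (e x) (he_fib x hx).1 (ψ x) hψx)
      hrev (fun t ht ↦ (hYoutprop (e x) (he_fib x hx).1 (ψ x) hψx t ht).1) hrevΩ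
      (by rw [hYout0 (e x) (he_fib x hx).1 (ψ x) hψx, sub_zero])
    have h := huniq h01
    simp only [sub_self] at h
    rw [hXin0 x hx] at h
    exact h
  have heΛ : ∀ q, f q = Φ 0 → ∀ u ∈ ball (0 : E) ε, e (Λ q u) = q := by
    intro q hq u hu
    obtain ⟨hΩ1, hψ1, -⟩ := hΛ_prop q hq u hu
    have hrev := liftChart_solution_reverse Φ (hYout q hq u hu)
    have hrevΩ : ∀ t ∈ Icc (0 : ℝ) 1, Yout q u (1 - t) ∈ Ω := fun t ht ↦
      (hYoutprop q hq u hu (1 - t) ⟨by linarith [ht.2], by linarith [ht.1]⟩).1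
    have hX := hXin (Λ q u) hΩ1
    have hψ1' : Φ.toPartialEquiv.symm (f (Λ q u)) = u := hψ1
    rw [hψ1'] at hX
    have huniq := liftChart_solution_unique Φ hπs hπ hε hX hrev
      (fun t ht ↦ (hXinprop (Λ q u) hΩ1 t ht).1) hrevΩ (by rw [hXin0 (Λ q u) hΩ1, sub_zero])
    have h := huniq h01
    simp only [sub_self] at h
    rw [hYout0 q hq u hu] at h
    exact h
  -- local constancy of `e` on `Ω`
  have hloc : ∀ x₀ ∈ Ω, ∀ᶠ x in 𝓝 x₀, e x = e x₀ := by
    intro x₀ hx₀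
    obtain ⟨η, hη, hηinj⟩ := hinj (e x₀)
    obtain ⟨δ, hδ, hnear⟩ := inward_lift_endpoint_near Φ g hπs hπ hε hg hgauss hCq hspeedIn hx₀ hη
    filter_upwards [hO.mem_nhds hx₀, Metric.ball_mem_nhds x₀ hδ] with x hx hxδ
    have hd := hnear x hx hxδ (Xin x₀) (Xin x) (hXin0 x₀ hx₀) (hXin0 x hx) (hXin x₀ hx₀) (hXin x hx)
    exact hηinj (mem_ball.2 hd) (mem_ball_self hη) ((he_fib x hx).1.trans (he_fib x₀ hx₀).1.symm)
  -- discreteness of the fibre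
  have hdisc : DiscreteTopology (f ⁻¹' {Φ 0}) := by
    refine discreteTopology_iff_isOpen_singleton.2 fun z ↦ ?_
    obtain ⟨η, hη, hηinj⟩ := hinj z
    have hopen' : IsOpen {w : f ⁻¹' {Φ 0} | (w : E) ∈ ball (z : E) η} :=
      isOpen_ball.preimage continuous_subtype_val
    convert hopen' using 1
    ext w
    simp only [mem_singleton_iff, mem_setOf_eq]
    constructor
    · rintro rfl; exact mem_ball_self hη
    · intro hw
      have hwf : f (w : E) = Φ 0 := w.2
      have hzf : f (z : E) = Φ 0 := z.2
      exact Subtype.ext (hηinj hw (mem_ball_self hη) (hwf.trans hzf.symm))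
  haveI := hdisc
  -- continuity of the endpoint map on the subtype
  have he_cont : Continuous fun x : f ⁻¹' U ↦ e x := by
    refine continuous_iff_continuousAt.2 fun x₀ ↦ ?_
    have hev : (fun x : f ⁻¹' U ↦ e x) =ᶠ[𝓝 x₀] fun _ ↦ e x₀ :=
      continuous_subtype_val.continuousAt.eventually (hloc x₀ x₀.2)
    exact continuousAt_const.congr hev.symm
  -- continuity of the outward endpoint in the chart parameter, for each fibre point
  have hΛ_cont : ∀ q : f ⁻¹' {Φ 0}, Continuous fun y : U ↦ Λ q (Φ.toPartialEquiv.symm y) := by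
    intro q
    refine continuous_iff_continuousAt.2 fun y₀ ↦ ?_
    have hq : f (q : E) = Φ 0 := q.2
    obtain ⟨hx₀Ω, hx₀ψ, hx₀f⟩ := hΛ_prop q hq _ (hUsymm y₀ y₀.2).1
    have hex₀ : e (Λ q (Φ.toPartialEquiv.symm y₀)) = q := heΛ q hq _ (hUsymm y₀ y₀.2).1
    refine tendsto_nhds.2 fun V hV hx₀V ↦ ?_
    have hW : V ∩ {x | x ∈ Ω ∧ e x = e (Λ q (Φ.toPartialEquiv.symm y₀))} ∈
        𝓝 (Λ q (Φ.toPartialEquiv.symm y₀)) := by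
      refine inter_mem (hV.mem_nhds hx₀V) ?_
      filter_upwards [hO.mem_nhds hx₀Ω, hloc _ hx₀Ω] with x hx hx'
      exact ⟨hx, hx'⟩
    obtain ⟨W, hWsub, hWo, hx₀W⟩ := _root_.mem_nhds_iff.1 hW
    have himg : f '' W ∈ 𝓝 (y₀ : M) := by
      refine (hopen W hWo).mem_nhds ⟨_, hx₀W, ?_⟩
      rw [hx₀f, (hUsymm y₀ y₀.2).2]
    have hpre : ∀ᶠ y : U in 𝓝 y₀, (y : M) ∈ f '' W :=
      continuous_subtype_val.continuousAt.preimage_mem_nhds himg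
    filter_upwards [hpre] with y hy
    obtain ⟨x₁, hx₁W, hx₁y⟩ := hy
    obtain ⟨hx₁V, hx₁Ω, hex₁⟩ := hWsub hx₁W
    have hkey : Λ q (Φ.toPartialEquiv.symm y) = x₁ := by
      have h1 := hΛe x₁ hx₁Ω
      rw [hex₁, hex₀] at h1
      have hψx₁ : ψ x₁ = Φ.toPartialEquiv.symm y := by
        change Φ.toPartialEquiv.symm (f x₁) = _
        rw [hx₁y]
      rw [hψx₁] at h1
      exact h1
    show Λ q (Φ.toPartialEquiv.symm y) ∈ V
    rw [hkey]
    exact hx₁V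
  -- the trivialising homeomorphism
  have hΛU : ∀ (y : U) (q : f ⁻¹' {Φ 0}), Λ q (Φ.toPartialEquiv.symm y) ∈ Ω := fun y q ↦
    (hΛ_prop q q.2 _ (hUsymm y y.2).1).1
  let H : f ⁻¹' U ≃ₜ U × f ⁻¹' {Φ 0} :=
  { toFun := fun x ↦ (⟨f x, x.2⟩, ⟨e x, (he_fib x x.2).1⟩)
    invFun := fun yq ↦ ⟨Λ yq.2 (Φ.toPartialEquiv.symm yq.1), hΛU yq.1 yq.2⟩
    left_inv := fun x ↦ Subtype.ext (hΛe x x.2)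
    right_inv := fun yq ↦ by
      obtain ⟨y, q⟩ := yq
      obtain ⟨-, -, h1⟩ := hΛ_prop q q.2 _ (hUsymm y y.2).1
      refine Prod.ext (Subtype.ext ?_) (Subtype.ext ?_)
      · show f (Λ q (Φ.toPartialEquiv.symm y)) = y
        rw [h1, (hUsymm y y.2).2]
      · exact heΛ q q.2 _ (hUsymm y y.2).1
    continuous_toFun := by
      refine Continuous.prodMk ?_ ?_
      · exact (hπs.continuous.comp continuous_subtype_val).subtype_mk _
      · exact he_cont.subtype_mk _
    continuous_invFun := by
      refine Continuous.subtype_mk ?_ _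
      exact continuous_prod_of_discrete_right.2 fun q ↦ hΛ_cont q }
  exact ⟨hdisc, U, hqU, hUo, hO, H, fun x ↦ rfl⟩

end Covering

end Literature.Geometry.Riemannian

end
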